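import Mathlib.LinearAlgebra.BilinearForm.Properties
import Literature.MathematicalPhysics.QuantumFieldTheory.Balaban1983to89.B9SupplySockB9P3ZdGammaUniv
import Literature.MathematicalPhysics.QuantumFieldTheory.Balaban1983to89.B7Prop5General
import Literature.MathematicalPhysics.QuantumFieldTheory.Balaban1983to89.B7Prop5LineDerivFiniteFamily
import Literature.MathematicalPhysics.QuantumFieldTheory.Balaban1983to89.B7LocalityGeneral

/-!
# `Balaban1983to89.B9Eq316AveragingTransposeZd` — [Balaban1985BackgroundPropagators] (3.16) p. 393: THE GENUINE AVERAGING LETTER `Q*aQ` OF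
# `Δ_a(U₀) = Δ + DRD* + Q*aQ` ((3.26)) AS AN OBJECT on the `ℤᵈ × 𝔸` carriers of the J-N06→N05 junction — print's own composite linear
# averaging `Q_j(U₀)` of [Balaban1985Averaging] (127) TRANSPOSED in the fibre at a CURVED background —, and the junction binder
# `B9SupplySockB9P3ZdGammaUniv.AvgAtP` ∕ `B9SupplySockB9P3ZdAt.AvgAt` ([Balaban1985RegularSpaces] (1.56)∕(1.58) «(Lʲη)³|Q*aQA| ≤ q|B₁|») PROVED
# for that letter at every member and every averaging class obeying print's collar law

statement-level skeleton of published theorems with citation tags; proofs where landed; nothing here is a claim about the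
Yang–Mills mass gap

`[Balaban1985BackgroundPropagators]` ("B9", CMP **99** (1985) 389–434; held `paper:balaban1985-cmp99-background-propagators`, journal page =
PDF page + 388) p. 393, verbatim: *«We define an operator Q*aQ by the quadratic form ⟨A, Q*aQA⟩ = Σ_{j=0}^{k} a Σ_{b∈Λ_j} (Lʲη)^{d−2}|(Q_j(U)A)(b)|².
(3.16) We will need also averaging operations for scalar functions … ⟨λ, λ′⟩ = Σ_{x∈Ω₀} η^d tr λ(x)λ′(x) (3.17)»*, (3.14) *«(1∕Lʲη)Q_j(U, ηA) =
Q_j(U)A + (1∕Lʲη)C_j(U, LʲηA)»*, (3.15) *«Q_j(U) = Q(Ū^{j−1})·…·Q(Ū)Q(U)»*, p. 395 *«Δ^η_a(U) = Δ^η(U) + D^η_U R(U) D^{η*}_U + Q*(U)aQ(U), (3.26)»*,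
p. 391 *«X·Y = tr XY»*; `[Balaban1985RegularSpaces]` ("B8", CMP **99** (1985) 75–102) p. 86 (1.56) *«Q_j(U₀, ηA) = LʲηQ_jA + C_j(LʲηA) … hence
LʲηQ_jA = B₁»*, (1.58) *«A = G(U₀)J + G(U₀)Σ_jQ*_jΛ_j(Lʲη)⁻³B₁»*, p. 77 (1.7) *«|U(∂p) − 1| < α₀L^{−2j} for p ∈ Ω_j»* (the class `𝔄_k({Ω_j}, α₀)`),
(1.31) p. 82 (the collars of the tower); `[Balaban1985Averaging]` ("B7" = B9's [5], CMP **98** (1985) 17–51; CMP equation numbers as cited by the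
tree's `B7*` files) (127) p. 37 (the composite `Q_j(U₀, ·)`), p. 38 *«Q_{j+1}(U₀) = Q(Ū₀ʲ)Q_j(U₀)»*, p. 24 *«Ū^k_c … depends only on the bond variables U_b
for b ⊂ B^k(c₋) ∪ B^k(c₊)»*, Prop. 3 (121)–(122) p. 36 (the averaging is defined, and linear + analytic, for REGULAR backgrounds), (141) p. 39, (147) p. 40
*«|Q_k(U₀; c, b)| ≦ 1 + 2C′₁α₀»*, Prop. 5 p. 42.  Pages re-read by this seat on the held text layers (2026-08-28).

CITATION HEADER (lean-in-tree rule).  Cell `pub-ymgap` (YM Track A, HUMAN RULING D-0062 ∕ D-0149), DAG node N06 = [B9], seat `pub-ymgap-dag-n06-b`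
gen 17 — the BINDER OWNER of the J-N06→N05 junction (`B9SupplySockB9P3ZdLetters` … `…GammaUnivDelta`, this lineage) —, plan `W-SEAT-START-LIST` v7
§ n06 ITEM 4 «(γ) Thm 3.3 at a curved U₀ at the carrier: the letters G(U₀), Δ′(U₀), R(U₀), Q*ⱼ AS OPERATORS + the binders PROVED — one binder per
seat», the `Q*ⱼ ∕ AvgAt` binder (UNOWNED until this file; dag-n06-w4 ■ INBOX 2026-08-28T01:14Z: «what remains … G(U₀) (`InvAt∕HolderAt`) and
Q*aQ (`AvgAt`), both needing the genuine averaging transpose»).  STATE OF THE RECORD BEFORE THIS FILE: the junction's operator layer is the PARAMETER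
RECORD `OpsZd` (`Gop ∕ Dp ∕ DRDs ∕ QQ` — «LETTERS, NOT OBJECTS»); the genuine `Dp = Δ′(U₀)` with its binder is dag-n06-w2's
`B9SupplySockB9P3ZdGammaInAkDpZd.curvAtInAk_withDpZd`, the genuine `DRDs = D R(U₀) D*` with `LandauAt` is dag-n06-w4's
`B9Eq321LandauProjectionZd.landauAt_opsLandau` (finite `Ω₀`); the `QQ` slot had no object (r06's `B9Eq316FormZd.form316` types the QUADRATIC FORM (3.16)
with finite-set letters, «the OPERATOR Q*aQ … not constructed on this carrier»; `B6AdjointAveraging` is the flat B5∕B6 `Q₁*`).  THIS FILE constructs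
the OPERATOR `Q*aQ` of (3.16) at a curved background on `ℤᵈ` (infinite `Ω₀` allowed: the transpose is locally finite) and PROVES the averaging binder
of record for it.  REUSED BY NAME: `B7Prop4GeneralLevels.linCovIter` (the composite linear averaging; = `Lʲ·Q_j(U₀)`, the un-normalised product of
[5]'s one-step linear parts `L·Q(V)` — `B7Eq122LinearPartIsLinear.QjOp`, `B9Eq315QTorus.QjOp_apply_eq_linCovIter` —; at the tree's exponent variable
`B = iηA` (`B8Eq146AExpansion.iEta`) it is `i·LʲηQ_j(U₀)A = i·B₁` of (1.56)), `B7Prop5General.prop5_general_147` ((147) per bond, GLOBAL regime),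
`B7Prop5GeneralLevels.{thetaGen, hadd_levels, hsmul_levels}`, `B7Prop5LineDerivFiniteFamily.linCovIter_family`, `B7Prop1Local.{clampCfg, clampCfg_agree,
clampCfg_mem, pdev_clampCfg_le, avgIter_congr}` (the clamped extension), `B7LocalityGeneral.Qcov_congr`, `B7Prop5Flat.{bump, bondsIn, …}`,
`B7Prop5FlatOperator.{card_boxFinset_K, card_bondsIn_le}`, `B8Ineq132.{InAk, plaqF, pdevOn_lt_of_forall}`, `B8Ineq130.hol_one`, `B8Eq155JBound.wsup`,
`B8ScaledSupNorm.{msup, Bdd, norm_le_of_msup_le}`, `B9SupplySockB9P3ZdLettersOmega.OnDom`, `B9SupplySockB9P3ZdGammaUniv.{AvgAtP, avgAtP_self}`,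
Mathlib's `LinearMap.BilinForm.dualBasis` (the `⟨·,·⟩_τ`-dual basis of `Module.finBasis ℝ 𝔸`).

DICTIONARY.  `τ : 𝔸 →ₗ[ℂ] ℂ` a trace-type functional of the fibre (dag-n06-w4's letter: faithful `Re τ(a*a) > 0`, Hermitian; on `M_N(ℂ)` the matrix trace,
`B9TracePairingMatrix`; on `ℂ` the identity), `⟨x, y⟩_τ = Re τ(x* y)` (`tauForm`) = print's «X·Y = tr XY» on the fibre; `C_τ` with `|Re τ(x*y)| ≤ C_τ‖x‖‖y‖`
(`= 1` on `ℂ`, `= N` on `M_N(ℂ)` with the operator norm); `β_τ = Σ_i ‖b_i‖‖b^i‖` (`betaTau`; canonical real basis of `𝔸` times its `⟨·,·⟩_τ`-dual basis).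
`LʲQ_j(U₀)` = `linCovIter L U₀ · j` on unit-lattice bond fields (level-`j` bonds `c = ⟨z, z + e_κ⟩` read on `ℤᵈ` after `j` rescalings, box `Bʲ(c₋) ∪ Bʲ(c₊)
= [Lʲz, Lʲz + (Lʲ−1)𝟙 + Lʲe_κ]` = `[loK L j z, bondHiK L j z κ]`); its COLUMN at the unit-lattice bond `b = ⟨y, y + e_μ⟩` = `X ↦ linCovIter L U₀ (bump y μ X) j z κ`
((147)'s `Q_j(U₀; c, b)`, an `𝔸 → 𝔸` map); `Q_jᵀ` = `linCovIterT` (§2); print's adjoint `Q*_j = L^{jd}·(Q_j)ᵀ = L^{jd}L^{−j}·linCovIterT` for the weights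
`η^d` ∕ `(Lʲη)^d` of (3.16)–(3.17); `|B₁|` = the socket's `wsup 1 (linCovIter L U₀ (iEta η A) …)` over the class `ΛbP` ([B8] (1.56)); the class (1.7) =
`Reg17` (the plaquette clause of `InAk`); `α_Q(d, L)` = `alphaQ` (one window inside [5] Prop. 5's).

WHAT IS DECLARED ∕ PROVED (kernel, 0 sorry; definitions WITH BODY + theorems; no `instance`, no `notation`, no `def … : Prop` hypothesis taken).
* §1 `tauForm τ` (def) · `tauForm_apply` · `tauForm_isSymm` (Hermitian `τ`) · `tauForm_nondegenerate` (faithful `τ`) · ★ `entryT τ E v` (def: THE τ-TRANSPOSE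
  `Eᵀv = Σ_i ⟨v, E b_i⟩_τ b^i` of an ARBITRARY map `E : 𝔸 → 𝔸` — total; `0` if `⟨·,·⟩_τ` is degenerate) · `betaTau τ` (def) (+ private plumbing `betaTau_nonneg`,
  `entryT_zero`, `entryT_add`) · ★ `tauForm_entryT` (`⟨Eᵀv, X⟩_τ = ⟨v, E X⟩_τ` for REAL-LINEAR `E`, faithful `τ` — it IS the transpose) · ★ `norm_entryT_le`
  (`‖Eᵀv‖ ≤ C_τβ_τK‖v‖` from `‖E b_i‖ ≤ K‖b_i‖` — NO linearity used).
* §2 `winBase L j y κ t` (def: the `≤ 2d` level-`j` bonds whose box contains `y`) · `inBox_winBase` · ★ `linCovIterT τ L U₀ j B` (def: `(Q_jᵀB)(⟨y, y+e_μ⟩) =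
  Σ_{κ,t}(column at c_{κ,t})ᵀ(B(c_{κ,t}))`) · ★ `norm_linCovIterT_le` (column bounds where `B ≠ 0` ⇒ `‖(Q_jᵀB)(b)‖ ≤ C_τβ_τK·Σ_{window}‖B‖`).
* §3 `alphaQ d L` (def) · `alphaQ_pos` · `C0_mul_alphaQ_le` · `four_mul_alphaQ_le` · `h145_alphaQ` (the three windows) · `Reg17 L m Ω α U₀` (def: (1.7) at levels
  `≤ m`) · `reg17_of_inAk` · `reg17_mono` · `reg17_one` (A6: `U₀ = 1` is in the class) · ★★ `norm_linCovIter_bump_le_of_reg17` — [5] PROP. 5 (147) LOCALISED: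
  for unitary `U₀ ∈ Reg17` (`α ≤ α_Q`), a level-`j` bond whose box lies in `Ω_j`, every `b`, `X`: `‖LʲQ_j(U₀)(X·δ_b)(c)‖ ≤ (1 + θ(α))·Lʲ·L^{−jd}·‖X‖` (the
  global theorem at the CLAMPED extension `π^*U₀` — globally `αL^{−2j}`-regular, `clamp_data` — transported by locality, the `B8Eq156KLevelLocal.eq156_loc`
  device; print has (1.7) on `Ω_j` only) · ★ `norm_linCovIter_le_of_reg17` (the ROW SUM: `‖LʲQ_j(U₀)B(c)‖ ≤ 2d(1+θ)Lʲ·sup_{box}‖B‖`, by locality + additivity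
  of the composite in the regime over the `2d·L^{jd}` bonds of the box).
* §4 `wQ L η j` (def: `(Lʲη)⁻³L^{jd}L^{−j}`) · `clsField` (def: `𝟙_{Λ_j}·(−i)·LʲQ_j(U₀)(iηA) = 𝟙_{Λ_j}LʲηQ_jA`) · ★★ `QQZd τ L ΛbP i m` (def: THE LETTER
  `(Q*aQ A)(b) = Σ_{j≤m} w_j·(Q_jᵀ(𝟙_{Λ_j}LʲηQ_jA))(b)` = print's `Σ_j(Lʲη)⁻²(Q*_jΛ_jQ_jA)(b)` in B8's normalisation (1.58), `a = 1`, ON the class (1.7) at `α_Q`;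
  `0` off it) · `withQQ τ L ΛbP ops₀` (def: the `QQ` field replaced) · `withQQ_QQ ∕ _Gop ∕ _Dp ∕ _DRDs` · `QQZd_of_reg17` · `QQZd_of_not_reg17` · `QQZd_of_inAk`
  (the letter is the genuine sum at every socket datum `U₀ ∈ 𝔄_k({Ω_j}, α₀)`, `α₀ ≤ α_Q`) · `LevelSepP L m Ω ΛbP s` (def: THE CLASS LAW — box of a level-`j`
  class bond `⊂ Ω_j`, and a unit bond at a box site touches `Ω_i` only for `i ≤ j + s`) · `qQ` (def: `q = 4d·C_τβ_τ(1+θ(α_Q))·L^{3s}`) ·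
  ★★★ `avgAtP_withQQ` : `AvgAtP L (withQQ τ L ΛbP ops₀) (qQ d L C_τ β_τ s) ΛbP M i m` for EVERY `M`, member `i`, `m`, `ops₀`, every class with
  `LevelSepP L m i.Ω ΛbP s` (`d ≥ 2`, `L ≥ 2`, `𝔸` finite-dimensional over `ℝ`, `|Re τ(x*y)| ≤ C_τ‖x‖‖y‖`) · ★★ `avgAt_withQQ` (the member's own class
  `i.Λb`: `B9SupplySockB9P3ZdAt.AvgAt`).
* §5b ★ `column_linear_of_reg17` (in the regime every column `X ↦ LʲQ_j(U₀)(X·δ_b)(c)` is additive and real-homogeneous ⇒ `entryT` of it IS its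
  `⟨·,·⟩_τ`-transpose by `tauForm_entryT`: the letter is the genuine transpose column by column).
* §5 A6: ★ `avgAtP_withQQ_complex` (`𝔸 = ℂ`, `τ = id`: no fibre hypothesis left).

PROOF OF `avgAtP_withQQ` (the shape of [B8] p. 86's use of Theorem 3.3 through (1.58)).  Off the class: `0 ≤ q|B₁|`.  On it: `A ∈ E(Ω₀)` is bounded
(`Bdd` at weight `(Lʲη)¹` at level `0`, support on the bonds touching `Ω₀`, `d ≥ 2`), so the family `{LʲηQ_jA(c)}_{c ∈ Λ_j, j ≤ m}` is bounded by the row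
sums (§3) and each value is `≤ |B₁|` (the real `iSup` is attained); at the bond `b` touching `Ω_{j₀}` the level-`j` term is the sum over the `≤ 2d` window bonds
of transposed columns — each bounded by (147) localised (§3) times `C_τβ_τ` (§1) —, non-zero only at CLASS window bonds, whose box contains `y`, whence
`j₀ ≤ j + s` by the law; the weights give `(L^{j₀}η)³·w_j·(1+θ)LʲL^{−jd} = (1+θ)L^{3(j₀−j)} = (1+θ)(L³)^s(L⁻³)^{j+s−j₀}` and `Σ_j (L⁻³)^{j+s−j₀} ≤ (1−L⁻³)⁻¹ ≤ 2`.

HONEST SCOPE.  (i) ONE letter of the record (`QQ`) is made an OBJECT and ONE binder (`AvgAtP`∕`AvgAt`) is PROVED for it; `Gop` (the propagator `G(U₀) =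
(Δ_a↾Ω₀)⁻¹`, [B9] Thm 3.11 + Thm 3.3 — binders `InvAt ∕ HolderAt ∕ SrcAt …`) is NOT touched; N06's object layer is NOT claimed complete.  (ii) THE REGIME
GUARD: [5] defines and estimates the averaging `Q(V₀, ·)` for REGULAR backgrounds only (Prop. 3; the tree's one-step linear part `linQcov` is a derivative at
`0`, meaningful in that regime); accordingly `QQZd` is print's operator ON the class (1.7) at the fixed window `α_Q(d, L)` and `0` off it — every socket datum
`U₀ ∈ 𝔄_k({Ω_j}, α₀)` with `α₀ ≤ α_Q(d, L)` is ON the class (`QQZd_of_inAk`); a supplier wanting the genuine letter at its datum adds `α₀ ≤ alphaQ d L` to its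
threshold `cP` (the binder itself holds at EVERY unitary `U₀`, as typed).  (iii) GENUINENESS: `entryT` is the `⟨·,·⟩_τ`-transpose of each column whenever the
column is real-linear (`tauForm_entryT`) — the case in the regime, PROVED (`column_linear_of_reg17`: [5] (122), `hadd_levels`∕`hsmul_levels` at the
clamped background) —; the summed pairing
identity `⟨Q_jᵀB, A⟩ = ⟨B, LʲQ_jA⟩` for finitely supported fields and the identification `⟨A, QQZd A⟩_τ = (3.16)` are NOT typed in this edition (v1.1).
(iv) The class law `LevelSepP` is DISPLAYED: its first clause is print's «Λ_j ⊂ Ω_j^{(j)}» ((1.5); the `ZdIdx.hbox` law for `i.Λb`), its second the collar of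
(1.31) ∕ [B6] (2.2); deriving it for the law owners' class `towerBondsP` (dag-n05-c∕-d∕-w1) is theirs; `s` is a parameter (`q` grows like `L^{3s}`).  (v) The
fibre constants `C_τ, β_τ` are explicit; `[FiniteDimensional ℝ 𝔸]` is assumed (w4's setting).  (vi) Count-neutral helper of K1⁷ (`--supports
stmt-QuantumFields-20542`); N05∕N06 NOT discharged; K1⁷ NOT closed; one finite `𝕋⁴` programme at fixed `ε`, Bałaban AS PRINTED; nothing continuum ∕ `ℝ⁴` ∕ OS ∕
mass-gap ∕ Clay.  Unit `pub-ymgap-dag-n06-b` (g17), 2026-08-28.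
-/

noncomputable section

open scoped BigOperators
open NormedSpace

namespace Literature.MathematicalPhysics.QuantumFieldTheory.Balaban1983to89.B9Eq316AveragingTransposeZd

-- `Site` alone could resolve to the torus sites of `Setup.lean`; re-export the `ℤ^d` sites of `B7Prop1Explicit`.
export B7Prop1Explicit (Site)

variable {d : ℕ} {𝔸 : Type*} [CStarAlgebra 𝔸]

/-! ## §1 The pairing `Re τ(x* y)` on the fibre `𝔸` and the τ-transpose of a map `𝔸 → 𝔸` -/

section Fibre

variable (τ : 𝔸 →ₗ[ℂ] ℂ)

/-- **THE FIBRE PAIRING `⟨x, y⟩_τ = Re τ(x* y)`** on `𝔸` as a real bilinear form — print's «X·Y = tr XY» on `𝔤 ⊂ u(N)` (for Hermitian-type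
arguments and a Hermitian trace `Re τ(x* y)` is `tr xy`); the fibre twin of `B9Eq321LandauProjectionZd.trForm` (which pairs FUNCTIONS
`ℤᵈ → 𝔸`). [cite: Balaban1985BackgroundPropagators, p.391 («X·Y = tr XY»), (3.17) p.393] -/
def tauForm : LinearMap.BilinForm ℝ 𝔸 :=
  LinearMap.mk₂ ℝ (fun x y => (τ (star x * y)).re)
    (fun x₁ x₂ y => by rw [star_add, add_mul, map_add, Complex.add_re])
    (fun c x y => by
      rw [star_smul, star_trivial, smul_mul_assoc, ← Complex.coe_smul, map_smul, smul_eq_mul, smul_eq_mul,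
        Complex.re_ofReal_mul])
    (fun x y₁ y₂ => by rw [mul_add, map_add, Complex.add_re])
    (fun c x y => by rw [mul_smul_comm, ← Complex.coe_smul, map_smul, smul_eq_mul, smul_eq_mul, Complex.re_ofReal_mul])

/-- the fibre pairing, unfolded. [cite: Balaban1985BackgroundPropagators, p.391 («X·Y = tr XY»)] -/
@[simp] theorem tauForm_apply (x y : 𝔸) : tauForm τ x y = (τ (star x * y)).re := rfl

/-- **SYMMETRY** of the fibre pairing for a Hermitian `τ` (`τ(a*) = conj τ(a)`). [cite: Balaban1985BackgroundPropagators, p.391 («X·Y = tr XY»)] -/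
theorem tauForm_isSymm (hτs : ∀ a : 𝔸, τ (star a) = starRingEnd ℂ (τ a)) : (tauForm τ).IsSymm := by
  refine ⟨fun x y => ?_⟩
  show (τ (star x * y)).re = (τ (star y * x)).re
  have h : star y * x = star (star x * y) := by rw [star_mul, star_star]
  rw [h, hτs, Complex.conj_re]

/-- **NONDEGENERACY** of the fibre pairing for a faithful positive `τ` (`Re τ(a* a) > 0` for `a ≠ 0`). [cite: Balaban1985BackgroundPropagators, p.391 («X·Y = tr XY»)] -/
theorem tauForm_nondegenerate (hτp : ∀ a : 𝔸, a ≠ 0 → 0 < (τ (star a * a)).re) : (tauForm τ).Nondegenerate := by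
  refine ⟨fun x hx => ?_, fun x hx => ?_⟩
  · by_contra hne
    exact (hτp x hne).ne' (hx x)
  · by_contra hne
    exact (hτp x hne).ne' (hx x)

variable [FiniteDimensional ℝ 𝔸]

open Classical in
/-- ★ **THE τ-TRANSPOSE OF A MAP `E : 𝔸 → 𝔸`**: `Eᵀv := Σ_i ⟨v, E bᵢ⟩_τ · b^i`, where `b` is the canonical finite real basis of `𝔸`
(`Module.finBasis`) and `b^i` its `⟨·,·⟩_τ`-dual basis (`⟨b^i, b_j⟩_τ = δ_ij`); a TOTAL definition for an arbitrary function `E` (no linearity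
asked), equal to the genuine transpose `⟨Eᵀv, X⟩_τ = ⟨v, E X⟩_τ` whenever `E` is real-linear (`tauForm_entryT`); `0` by convention if the
pairing is degenerate.  Used below entry by entry on the kernel of the linear averaging `Q_j(U)` to build print's adjoint `Q*_j`.
[cite: Balaban1985BackgroundPropagators, (3.16) p.393 («an operator Q*aQ»), p.391 («X·Y = tr XY»)] -/
def entryT (E : 𝔸 → 𝔸) (v : 𝔸) : 𝔸 :=
  if h : (tauForm τ).Nondegenerate then
    ∑ i, tauForm τ v (E (Module.finBasis ℝ 𝔸 i)) • (tauForm τ).dualBasis h (Module.finBasis ℝ 𝔸) i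
  else 0

open Classical in
/-- **THE BASIS CONSTANT `β_τ = Σ_i ‖b_i‖·‖b^i‖`** of the fibre (canonical basis times its `⟨·,·⟩_τ`-dual basis; `0` if degenerate) — the only
fibre constant the transpose bounds below carry. [cite: Balaban1985BackgroundPropagators, p.391 («X·Y = tr XY»)] -/
def betaTau : ℝ :=
  if h : (tauForm τ).Nondegenerate then
    ∑ i, ‖Module.finBasis ℝ 𝔸 i‖ * ‖(tauForm τ).dualBasis h (Module.finBasis ℝ 𝔸) i‖
  else 0

/-- `β_τ ≥ 0`. [folklore] -/
private theorem betaTau_nonneg : 0 ≤ betaTau τ := by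
  unfold betaTau
  split_ifs
  · exact Finset.sum_nonneg fun i _ => mul_nonneg (norm_nonneg _) (norm_nonneg _)
  · exact le_rfl

/-- `Eᵀ` of the zero vector is `0`. [folklore] -/
private theorem entryT_zero (E : 𝔸 → 𝔸) : entryT τ E 0 = 0 := by
  unfold entryT
  split_ifs
  · simp
  · rfl

/-- `Eᵀv` is additive in `v` (for every `E`). [folklore] -/
private theorem entryT_add (E : 𝔸 → 𝔸) (v w : 𝔸) : entryT τ E (v + w) = entryT τ E v + entryT τ E w := by
  unfold entryT
  split_ifs
  · rw [← Finset.sum_add_distrib]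
    refine Finset.sum_congr rfl fun i _ => ?_
    rw [map_add, LinearMap.add_apply, add_smul]
  · rw [add_zero]

/-- ★ **`Eᵀ` IS THE TRANSPOSE**: for a faithful positive `τ` and a REAL-LINEAR `E` (additive and real-homogeneous — the composite linear
averaging in its regime), `⟨Eᵀv, X⟩_τ = ⟨v, E X⟩_τ` for all `v, X`. [cite: Balaban1985BackgroundPropagators, (3.16) p.393 («an operator Q*aQ»)] -/
theorem tauForm_entryT (hτp : ∀ a : 𝔸, a ≠ 0 → 0 < (τ (star a * a)).re) {E : 𝔸 → 𝔸}
    (hEadd : ∀ x y, E (x + y) = E x + E y) (hEsmul : ∀ (c : ℝ) x, E (c • x) = c • E x) (v X : 𝔸) :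
    tauForm τ (entryT τ E v) X = tauForm τ v (E X) := by
  classical
  have hN := tauForm_nondegenerate τ hτp
  -- the real-linear map agreeing with `E`
  let El : 𝔸 →ₗ[ℝ] 𝔸 := { toFun := E, map_add' := hEadd, map_smul' := hEsmul }
  -- both sides are real-linear in `X`; compare them on the canonical basis
  have key : tauForm τ (entryT τ E v) = (tauForm τ v).comp El := by
    refine (Module.finBasis ℝ 𝔸).ext fun j => ?_
    rw [LinearMap.comp_apply]
    show tauForm τ (entryT τ E v) (Module.finBasis ℝ 𝔸 j) = tauForm τ v (E (Module.finBasis ℝ 𝔸 j))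
    unfold entryT
    rw [dif_pos hN, map_sum, LinearMap.sum_apply]
    simp_rw [map_smul, LinearMap.smul_apply, smul_eq_mul, LinearMap.BilinForm.apply_dualBasis_left]
    rw [Finset.sum_eq_single j]
    · rw [if_pos rfl, mul_one]
    · intro i _ hij
      rw [if_neg (fun h => hij h.symm), mul_zero]
    · intro hj
      exact absurd (Finset.mem_univ j) hj
  exact LinearMap.congr_fun key X

/-- ★ **THE TRANSPOSE BOUND FROM PER-BASIS-VECTOR BOUNDS**: if `‖E b_i‖ ≤ K‖b_i‖` on the canonical basis and `|Re τ(x* y)| ≤ C_τ‖x‖‖y‖`, then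
`‖Eᵀv‖ ≤ C_τ·β_τ·K·‖v‖` — NO linearity of `E` is used (so the bound holds entry by entry for the composite averaging at every background
where [5] Prop. 5's per-bond estimate (147) holds). [cite: Balaban1985Averaging, (147) p.40; Balaban1985BackgroundPropagators, (3.16) p.393] -/
theorem norm_entryT_le [Nontrivial 𝔸] {Cτ : ℝ} (hCτ : ∀ x y : 𝔸, |(τ (star x * y)).re| ≤ Cτ * ‖x‖ * ‖y‖) {E : 𝔸 → 𝔸} {K : ℝ} (hK : 0 ≤ K)
    (hE : ∀ i, ‖E (Module.finBasis ℝ 𝔸 i)‖ ≤ K * ‖Module.finBasis ℝ 𝔸 i‖) (v : 𝔸) :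
    ‖entryT τ E v‖ ≤ Cτ * betaTau τ * K * ‖v‖ := by
  classical
  have hCτ0 : 0 ≤ Cτ := by
    have h := hCτ 1 1
    simp only [norm_one, mul_one] at h
    exact (abs_nonneg _).trans h
  unfold entryT betaTau
  split_ifs with hN
  · calc ‖∑ i, tauForm τ v (E (Module.finBasis ℝ 𝔸 i)) • (tauForm τ).dualBasis hN (Module.finBasis ℝ 𝔸) i‖
        ≤ ∑ i, ‖tauForm τ v (E (Module.finBasis ℝ 𝔸 i)) • (tauForm τ).dualBasis hN (Module.finBasis ℝ 𝔸) i‖ := norm_sum_le _ _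
      _ ≤ ∑ i, Cτ * ‖v‖ * (K * ‖Module.finBasis ℝ 𝔸 i‖) * ‖(tauForm τ).dualBasis hN (Module.finBasis ℝ 𝔸) i‖ := by
          refine Finset.sum_le_sum fun i _ => ?_
          rw [norm_smul, Real.norm_eq_abs, tauForm_apply]
          refine mul_le_mul_of_nonneg_right ?_ (norm_nonneg _)
          exact (hCτ _ _).trans (mul_le_mul_of_nonneg_left (hE i) (mul_nonneg hCτ0 (norm_nonneg _)))
      _ = Cτ * (∑ i, ‖Module.finBasis ℝ 𝔸 i‖ * ‖(tauForm τ).dualBasis hN (Module.finBasis ℝ 𝔸) i‖) * K * ‖v‖ := by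
          rw [Finset.mul_sum, Finset.sum_mul, Finset.sum_mul]
          refine Finset.sum_congr rfl fun i _ => ?_
          ring
  · rw [norm_zero]; positivity

end Fibre


/-! ## §2 The transpose `Q_jᵀ` of the composite linear averaging `LʲηQ_j(U₀)` at a curved background -/

section Transpose

open B7Prop1Local (InBox loK bondHiK)
open B7Prop5Flat (bump)
open B7Prop4GeneralLevels (linCovIter)

variable (τ : 𝔸 →ₗ[ℂ] ℂ) [FiniteDimensional ℝ 𝔸]

omit [FiniteDimensional ℝ 𝔸] in
/-- **THE WINDOW OF A SITE AT LEVEL `j`**: the base points `x` of the (at most `2d`) bonds `c = ⟨x, x + e_κ⟩` of the `j`-lattice whose box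
`Bʲ(c₋) ∪ Bʲ(c₊) = [Lʲx, Lʲx + (Lʲ − 1)𝟙 + Lʲe_κ]` contains the site `y`: `x_i = ⌊y_i∕Lʲ⌋` off the direction `κ`, `x_κ ∈ {⌊y_κ∕Lʲ⌋, ⌊y_κ∕Lʲ⌋ − 1}`
(`t = 0, 1`) — the locality «depends only on the bond variables for b ⊂ B^k(c₋) ∪ B^k(c₊)» read column-wise. [cite: Balaban1985Averaging, p.24 (after (43)), (141) p.39] -/
def winBase (L j : ℕ) (y : Site d) (κ : Fin d) (t : Fin 2) : Site d :=
  fun i => y i / (L : ℤ) ^ j - (if i = κ then ((t : ℕ) : ℤ) else 0)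

omit [FiniteDimensional ℝ 𝔸] in
/-- Euclidean division bounds: `P·(a∕P) ≤ a ≤ P·(a∕P) + P − 1` (`P > 0`). [folklore] -/
private theorem ediv_bounds {P : ℤ} (hP : 0 < P) (a : ℤ) : P * (a / P) ≤ a ∧ a ≤ P * (a / P) + P - 1 := by
  have h1 := Int.ediv_mul_le a hP.ne'
  have h2 := Int.lt_ediv_add_one_mul_self a hP
  constructor <;> nlinarith

omit [CStarAlgebra 𝔸] [FiniteDimensional ℝ 𝔸] in
/-- **EVERY WINDOW BOND'S BOX CONTAINS THE SITE**: `y ∈ [Lʲx, Lʲx + (Lʲ − 1)𝟙 + Lʲe_κ]` for `x = winBase L j y κ t` (`L ≥ 1`).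
[cite: Balaban1985Averaging, p.24 (after (43))] -/
theorem inBox_winBase {L : ℕ} (hL : 1 ≤ L) (j : ℕ) (y : Site d) (κ : Fin d) (t : Fin 2) :
    InBox (loK L j (winBase L j y κ t)) (bondHiK L j (winBase L j y κ t) κ) y := by
  intro i
  have hP : (0 : ℤ) < (L : ℤ) ^ j := by positivity
  obtain ⟨h1, h2⟩ := ediv_bounds hP (y i)
  have ht : ((t : ℕ) : ℤ) ≤ 1 := by have := t.2; omega
  have ht0 : (0 : ℤ) ≤ ((t : ℕ) : ℤ) := by positivity
  simp only [loK, bondHiK, winBase]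
  split_ifs with hi
  · constructor <;> nlinarith
  · simp only [sub_zero, add_zero]
    constructor <;> linarith

/-- ★ **THE TRANSPOSE `Q_jᵀ` OF THE COMPOSITE LINEAR AVERAGING `LʲηQ_j(U₀)`** ([5] (127), p. 38 «Q_{j+1}(U₀) = Q(Ū₀ʲ)Q_j(U₀)»,
`B7Prop4GeneralLevels.linCovIter`) at an ARBITRARY background, as a TOTAL function on `j`-lattice bond fields `B`:
`(Q_jᵀB)(⟨y, y + e_μ⟩) := Σ_{κ} Σ_{t=0,1} (X ↦ LʲηQ_j(U₀)(X·δ_{⟨y,y+e_μ⟩})(c_{κ,t}))ᵀ (B(c_{κ,t}))`, the sum over the window bonds `c_{κ,t} =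
⟨winBase L j y κ t, · + e_κ⟩` (all bonds whose box can contain `⟨y, y+e_μ⟩`; the entries vanish at the others by locality), each ENTRY — the
column `X ↦ Q_j(U₀; c, b)X` of (147) — transposed in the fibre by `entryT`.  In the regime of [5] Prop. 5 this is the `⟨·,·⟩_τ`-transpose of
`A ↦ LʲηQ_j(U₀)A`; print's adjoint for the weights `η^d` (fine) and `(Lʲη)^d` (level `j`) of (3.16)–(3.17) is `Q*_j = L^{jd}·Q_jᵀ` composed
with the normalisation `Q_j = (Lʲ)⁻¹·(LʲQ_j)`. [cite: Balaban1985BackgroundPropagators, (3.16) p.393, (3.14)–(3.15) p.393; Balaban1985Averaging, (127) p.37, (147) p.40] -/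
def linCovIterT (L : ℕ) (U₀ : Site d → Fin d → 𝔸ˣ) (j : ℕ) (B : Site d → Fin d → 𝔸) (y : Site d) (μ : Fin d) : 𝔸 :=
  ∑ κ : Fin d, ∑ t : Fin 2,
    entryT τ (fun X => linCovIter L U₀ (bump y μ X) j (winBase L j y κ t) κ) (B (winBase L j y κ t) κ)

/-- ★ **THE TRANSPOSE IS BOUNDED COLUMN BY COLUMN**: if at every window bond `c` where `B(c) ≠ 0` the column of (147) obeys
`‖LʲηQ_j(U₀)(X·δ_b)(c)‖ ≤ K‖X‖`, then `‖(Q_jᵀB)(b)‖ ≤ C_τ·β_τ·K·Σ_{c ∈ window} ‖B(c)‖` (no linearity used). [cite: Balaban1985Averaging, (147) p.40; Balaban1985BackgroundPropagators, (3.16) p.393] -/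
theorem norm_linCovIterT_le [Nontrivial 𝔸] {Cτ : ℝ} (hCτ : ∀ x y : 𝔸, |(τ (star x * y)).re| ≤ Cτ * ‖x‖ * ‖y‖)
    (L : ℕ) (U₀ : Site d → Fin d → 𝔸ˣ) (j : ℕ) (B : Site d → Fin d → 𝔸) (y : Site d) (μ : Fin d) {K : ℝ} (hK : 0 ≤ K)
    (hcol : ∀ (κ : Fin d) (t : Fin 2), B (winBase L j y κ t) κ ≠ 0 →
      ∀ X : 𝔸, ‖linCovIter L U₀ (bump y μ X) j (winBase L j y κ t) κ‖ ≤ K * ‖X‖) :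
    ‖linCovIterT τ L U₀ j B y μ‖ ≤ Cτ * betaTau τ * K * ∑ κ : Fin d, ∑ t : Fin 2, ‖B (winBase L j y κ t) κ‖ := by
  unfold linCovIterT
  rw [Finset.mul_sum]
  refine (norm_sum_le _ _).trans (Finset.sum_le_sum fun κ _ => ?_)
  rw [Finset.mul_sum]
  refine (norm_sum_le _ _).trans (Finset.sum_le_sum fun t _ => ?_)
  by_cases hB : B (winBase L j y κ t) κ = 0
  · rw [hB, entryT_zero, norm_zero, mul_zero]
  · exact norm_entryT_le τ hCτ hK (fun i => hcol κ t hB _) _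

end Transpose

/-! ## §3 The regime: print's class (1.7) at a fixed window `α_Q(d, L)`, and [5] Prop. 5 (147) LOCALISED to a bond whose box lies in `Ω_j` -/

section Regime

open B7Prop1Explicit (U1 e)
open B7Prop1Local (InBox AgreeOn PlaqIn loK bondHiK bondHi clampCfg clampCfg_agree clampCfg_mem pdev_clampCfg_le avgIter_congr
  add_e_apply)
open B7Prop2Explicit (pdev AvgClosed C0 c2' C0_pos c2'_pos avgIter unitaryUnits avgClosed_unitaryUnits)
open B7Prop5Flat (BondIn bump bondsIn restr insCfg_restr_of_mem mem_bondsIn agreeOn_insCfg_restr inBox_nest boxFinset mem_boxFinset)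
open B7Prop3Flat (insCfg)
open B7Prop3GeneralLinear (Qcov linQcov)
open B7Prop4GeneralLevels (logCovIter linCovIter linCovIter_succ linCovIter_zero)
open B7Prop5GeneralLevels (thetaGen hadd_levels hsmul_levels)
open B7Prop5General (prop5_general_147)
open B7Prop5LineDerivFiniteFamily (linCovIter_family)
open B7Prop5FlatOperator (card_boxFinset_K card_bondsIn_le)
open B7LocalityGeneral (Qcov_congr)
open B8Ineq132 (plaqF pdevOn_lt_of_forall CondAt InAk PlaqTouches BondTouches)
open B8Ineq130 (hol_one)

/-- **THE WINDOW `α_Q(d, L)`**: ONE positive number inside the three windows of [5] Proposition 5 at a general background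
(`C₀α ≤ 1∕3`, `4α ≤ c₂′(d,L)`, «16dC′₁L⁻⁴α₀ ≦ 1» = `8dθ(α)L⁻⁴ ≤ 1`, `θ = thetaGen d L α`) — the regularity at which the composite averaging's
column bound (147) is in the tree. [cite: Balaban1985Averaging, Prop. 5 p.42, (145)–(147) p.40, Prop. 1 (51) p.26] -/
def alphaQ (d L : ℕ) : ℝ :=
  min (min (1 / (3 * C0 d)) (c2' d L / 4)) (1 / (25600 * ((d : ℝ) + 1) ^ 2 * ((d : ℝ) + 4) * (L : ℝ) ^ (d + 1)))

/-- `α_Q > 0` (`L ≥ 1`). [cite: Balaban1985Averaging, Prop. 5 p.42] -/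
theorem alphaQ_pos (d : ℕ) {L : ℕ} (hL : 1 ≤ L) : 0 < alphaQ d L := by
  have h1 := C0_pos d
  have h2 := c2'_pos d L hL
  have hL' : (0 : ℝ) < L := by exact_mod_cast hL
  unfold alphaQ
  refine lt_min (lt_min (by positivity) (by positivity)) (by positivity)

/-- the first window `C₀α_Q ≤ 1∕3`. [cite: Balaban1985Averaging, Prop. 2 (53) p.26] -/
theorem C0_mul_alphaQ_le (d L : ℕ) : C0 d * alphaQ d L ≤ 1 / 3 := by
  have h1 := C0_pos d
  have h : alphaQ d L ≤ 1 / (3 * C0 d) := (min_le_left _ _).trans (min_le_left _ _)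
  calc C0 d * alphaQ d L ≤ C0 d * (1 / (3 * C0 d)) := mul_le_mul_of_nonneg_left h h1.le
    _ = 1 / 3 := by field_simp

/-- the second window `4α_Q ≤ c₂′`. [cite: Balaban1985Averaging, Prop. 1 (51) p.26] -/
theorem four_mul_alphaQ_le (d L : ℕ) : 4 * alphaQ d L ≤ c2' d L := by
  have h : alphaQ d L ≤ c2' d L / 4 := (min_le_left _ _).trans (min_le_right _ _)
  linarith

/-- the third window «16dC′₁L⁻⁴α₀ ≦ 1»: `8d·θ(α_Q)·L⁻⁴ ≤ 1` (`L ≥ 1`). [cite: Balaban1985Averaging, (145) p.40] -/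
theorem h145_alphaQ (d : ℕ) {L : ℕ} (hL : 1 ≤ L) : 8 * d * thetaGen d L (alphaQ d L) * (L : ℝ)⁻¹ ^ 4 ≤ 1 := by
  have hL' : (1 : ℝ) ≤ L := by exact_mod_cast hL
  have hL0 : (0 : ℝ) < L := by linarith
  have h : alphaQ d L ≤ 1 / (25600 * ((d : ℝ) + 1) ^ 2 * ((d : ℝ) + 4) * (L : ℝ) ^ (d + 1)) := min_le_right _ _
  have hD : (0 : ℝ) < 25600 * ((d : ℝ) + 1) ^ 2 * ((d : ℝ) + 4) * (L : ℝ) ^ (d + 1) := by positivity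
  have hθ : thetaGen d L (alphaQ d L) ≤ 3200 * ((d : ℝ) + 1) * ((d : ℝ) + 4) * (L : ℝ) ^ (d + 1) *
      (1 / (25600 * ((d : ℝ) + 1) ^ 2 * ((d : ℝ) + 4) * (L : ℝ) ^ (d + 1))) := by
    unfold thetaGen
    exact mul_le_mul_of_nonneg_left h (by positivity)
  have hθ' : thetaGen d L (alphaQ d L) ≤ 1 / (8 * ((d : ℝ) + 1)) := by
    refine hθ.trans (le_of_eq ?_)
    field_simp
    ring
  have hinv : (L : ℝ)⁻¹ ^ 4 ≤ 1 := by
    have : (L : ℝ)⁻¹ ≤ 1 := inv_le_one_of_one_le₀ hL'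
    exact pow_le_one₀ (by positivity) this
  have hd : (0 : ℝ) ≤ d := Nat.cast_nonneg d
  have hθ0 : 0 ≤ thetaGen d L (alphaQ d L) := by
    have := alphaQ_pos d hL
    unfold thetaGen; positivity
  calc 8 * d * thetaGen d L (alphaQ d L) * (L : ℝ)⁻¹ ^ 4
      ≤ 8 * d * (1 / (8 * ((d : ℝ) + 1))) * 1 := by
        refine mul_le_mul (mul_le_mul_of_nonneg_left hθ' (by positivity)) hinv (by positivity) (by positivity)
    _ = d / (d + 1) := by field_simp
    _ ≤ 1 := by rw [div_le_one (by positivity)]; linarith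

/-- **PRINT'S CLASS (1.7) AT THE LEVELS `≤ m`** — «|U(∂p) − 1| < α₀L^{−2j} for p ∈ Ω_j, j = 0, 1, …» (the plaquette clause of
`B8Ineq132.InAk`∕`CondAt`, touching convention of p. 77): the REGIME on which the averaging letter below is print's operator.
[cite: Balaban1985RegularSpaces, (1.7) p.77] -/
def Reg17 (L m : ℕ) (Ω : ℕ → Set (Site d)) (α : ℝ) (U₀ : Site d → Fin d → 𝔸ˣ) : Prop :=
  ∀ j, j ≤ m → ∀ (x : Site d) (μ ν : Fin d), μ ≠ ν → PlaqTouches (Ω j) x μ ν →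
    ‖plaqF U₀ μ ν x - 1‖ < α * (((L : ℝ) ^ j)⁻¹) ^ 2

/-- `𝔄_k({Ω_j}, α)` (`InAk`) lies in the class (1.7) at every truncation `m ≤ k`. [cite: Balaban1985RegularSpaces, (1.7) p.77] -/
theorem reg17_of_inAk {L k m : ℕ} {η α : ℝ} {Ω : ℕ → Set (Site d)} {U₀ : Site d → Fin d → 𝔸ˣ}
    (h : InAk L k η α Ω U₀) (hm : m ≤ k) : Reg17 L m Ω α U₀ :=
  fun j hj x μ ν hμν hp => (h j (hj.trans hm)).1 x μ ν hμν hp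

/-- the class (1.7) grows with `α`. [cite: Balaban1985RegularSpaces, (1.7) p.77] -/
theorem reg17_mono {L m : ℕ} {Ω : ℕ → Set (Site d)} {α α' : ℝ} (hαα' : α ≤ α') {U₀ : Site d → Fin d → 𝔸ˣ}
    (h : Reg17 L m Ω α U₀) : Reg17 L m Ω α' U₀ :=
  fun j hj x μ ν hμν hp => (h j hj x μ ν hμν hp).trans_le (mul_le_mul_of_nonneg_right hαα' (by positivity))

/-- **THE CLASS (1.7) IS INHABITED**: the unit configuration `U₀ = 1` lies in it for every `α > 0` (A6: the regime guard of the letter below is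
not vacuous). [cite: Balaban1985RegularSpaces, (1.7) p.77] -/
theorem reg17_one {L : ℕ} (hL : 1 ≤ L) {m : ℕ} {Ω : ℕ → Set (Site d)} {α : ℝ} (hα : 0 < α) :
    Reg17 L m Ω α (1 : Site d → Fin d → 𝔸ˣ) := by
  have hL0 : (0 : ℝ) < L := by exact_mod_cast hL
  intro j _ x μ ν _ _
  rw [plaqF, hol_one, Units.val_one, sub_self, norm_zero]
  positivity

variable [Nontrivial 𝔸]

omit [Nontrivial 𝔸] in
/-- **Locality of the one-step linear part (122)** jointly in `(V₀, A)` (private copy of the lineage's lemma — public twins on the Summits side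
and in `B8Eq156KLevelLocal`, private there). [cite: Balaban1985Averaging, (122) p.36, p.24] -/
private theorem linQcov_congr (L : ℕ) (hL : 1 ≤ L) (q : Site d) (κ : Fin d) {V₀ V₀' : Site d → Fin d → 𝔸ˣ}
    {A A' : Site d → Fin d → 𝔸} (h₀ : AgreeOn q (bondHi L q κ) V₀ V₀') (hA : AgreeOn q (bondHi L q κ) A A') :
    linQcov L V₀ A q κ = linQcov L V₀' A' q κ := by
  unfold linQcov
  congr 1
  funext t
  exact Qcov_congr L hL q κ h₀ fun x μ hx hxe => by
    show t • A x μ = t • A' x μ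
    rw [hA x μ hx hxe]

omit [Nontrivial 𝔸] in
/-- **Locality of the composite linear averaging `LʲηQ_jA(c)`** in the bonds of `Bʲ(c₋) ∪ Bʲ(c₊)`, jointly in `(U₀, A)` (private copy).
[cite: Balaban1985Averaging, p.24 (after (43)), p.38 (before (133))] -/
private theorem linCovIter_congr (L : ℕ) (hL : 1 ≤ L) :
    ∀ (j : ℕ) {U₀ U₀' : Site d → Fin d → 𝔸ˣ} {B B' : Site d → Fin d → 𝔸} (z : Site d) (κ : Fin d),
      AgreeOn (loK L j z) (bondHiK L j z κ) U₀ U₀' → AgreeOn (loK L j z) (bondHiK L j z κ) B B' →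
        linCovIter L U₀ B j z κ = linCovIter L U₀' B' j z κ
  | 0, U₀, U₀', B, B', z, κ, _, h => by
    refine h z κ (fun i => ?_) (fun i => ?_)
    · simp only [loK, bondHiK, pow_zero, one_mul]; split_ifs <;> omega
    · simp only [loK, bondHiK, pow_zero, one_mul, add_e_apply]; split_ifs <;> omega
  | j + 1, U₀, U₀', B, B', z, κ, h₀, h => by
    rw [linCovIter_succ, linCovIter_succ]
    refine linQcov_congr L hL _ κ (fun x μ hx hxe => ?_) (fun x μ hx hxe => ?_)
    · exact avgIter_congr L hL j x μ fun p ν hp hpν =>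
        h₀ p ν (inBox_nest L j z κ ⟨hx, hxe⟩ hp) (inBox_nest L j z κ ⟨hx, hxe⟩ hpν)
    · exact linCovIter_congr L hL j x μ
        (fun p ν hp hpν => h₀ p ν (inBox_nest L j z κ ⟨hx, hxe⟩ hp) (inBox_nest L j z κ ⟨hx, hxe⟩ hpν))
        (fun p ν hp hpν => h p ν (inBox_nest L j z κ ⟨hx, hxe⟩ hp) (inBox_nest L j z κ ⟨hx, hxe⟩ hpν))

omit [CStarAlgebra 𝔸] [Nontrivial 𝔸] in
/-- the box is a genuine box: `loK ≤ bondHiK` coordinatewise (`L ≥ 1`). [folklore] -/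
private theorem loK_le_bondHiK {L : ℕ} (hL : 1 ≤ L) (j : ℕ) (z : Site d) (κ : Fin d) (i : Fin d) :
    loK L j z i ≤ bondHiK L j z κ i := by
  have hP : (1 : ℤ) ≤ (L : ℤ) ^ j := one_le_pow₀ (by exact_mod_cast hL)
  simp only [loK, bondHiK]
  split_ifs <;> omega

/-- the clamped extension `π^*U₀` of a configuration in the class (1.7) at a bond of the `j`-lattice whose box lies in `Ω_j` is GLOBALLY
`αL^{−2j}`-regular, unitary, and agrees with `U₀` on the box (`B7Prop1Local.clampCfg`, the `B8Eq156KLevelLocal.eq156_loc` device).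
[cite: Balaban1985Averaging, p.24 (locality), Prop. 1 (51) p.26; Balaban1985RegularSpaces, (1.7) p.77] -/
private theorem clamp_data {L : ℕ} (hL : 1 ≤ L) {m : ℕ} {Ω : ℕ → Set (Site d)} {α : ℝ} (hα : 0 < α)
    {U₀ : Site d → Fin d → 𝔸ˣ} (hU₀ : ∀ x κ, U₀ x κ ∈ unitaryUnits 𝔸) (hreg : Reg17 L m Ω α U₀)
    {j : ℕ} (hj : j ≤ m) (z : Site d) (κ : Fin d) (hbox : ∀ x, InBox (loK L j z) (bondHiK L j z κ) x → x ∈ Ω j) :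
    (∀ x ν, clampCfg (loK L j z) (bondHiK L j z κ) U₀ x ν ∈ unitaryUnits 𝔸) ∧
      pdev (clampCfg (loK L j z) (bondHiK L j z κ) U₀) < α * (((L : ℝ) ^ j)⁻¹) ^ 2 ∧
      AgreeOn (loK L j z) (bondHiK L j z κ) (clampCfg (loK L j z) (bondHiK L j z κ) U₀) U₀ := by
  have hU₀U1 : ∀ x μ, U₀ x μ ∈ U1 𝔸 := fun x μ => (avgClosed_unitaryUnits d L).le_U1 (hU₀ x μ)
  have hL0 : (0 : ℝ) < L := by exact_mod_cast hL
  refine ⟨clampCfg_mem hU₀, ?_, clampCfg_agree U₀⟩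
  have hpdOn : B7Prop1Local.pdevOn (loK L j z) (bondHiK L j z κ) U₀ < α * (((L : ℝ) ^ j)⁻¹) ^ 2 := by
    refine pdevOn_lt_of_forall (by positivity) fun x μ ν hx hx' => ?_
    rcases eq_or_ne μ ν with rfl | hμν
    · rw [B7Prop2Explicit.hol_plaqWord_self, Units.val_one, sub_self, norm_zero]; positivity
    · exact hreg j hj x μ ν hμν (Or.inl (hbox x hx))
  exact (pdev_clampCfg_le (loK_le_bondHiK hL j z κ) hU₀U1).trans_lt hpdOn

/-- ★★ **[5] PROPOSITION 5 (147) LOCALISED — THE COLUMN OF THE COMPOSITE AVERAGING AT A BOND OF `Λ_j` FROM THE CLASS (1.7)**: for a unitary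
`U₀` in the class (1.7) up to level `m` with window `α ≤ α_Q(d,L)`, a bond `c = ⟨z, z + e_κ⟩` of the `j`-lattice (`j ≤ m`) whose box
`Bʲ(c₋) ∪ Bʲ(c₊)` lies in `Ω_j`, every unit-lattice bond `b = ⟨y, y + e_μ⟩` and `X ∈ 𝔸`:
`‖LʲηQ_j(U₀)(X·δ_b)(c)‖ ≤ (1 + θ(α))·Lʲ·L^{−jd}·‖X‖` — «|Q_k(U₀; c, b)| ≦ 1 + 2C′₁α₀» with the un-normalisation `Lʲ` and the weight `L^{−jd}`
of (138).  The GLOBAL theorem `B7Prop5General.prop5_general_147` needs `|U₀(∂p) − 1| < αL^{−2j}` on ALL of `ℤᵈ`; print has it on `Ω_j`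
only — the gap is closed by the clamped extension (`clamp_data`) and locality (`linCovIter_congr`). [cite: Balaban1985Averaging, (147) p.40, Prop. 5 (156) p.42, p.24; Balaban1985RegularSpaces, (1.7) p.77, p.86 («Proposition 4 from [3] implies»)] -/
theorem norm_linCovIter_bump_le_of_reg17 {L : ℕ} (hL : 2 ≤ L) {m : ℕ} {Ω : ℕ → Set (Site d)} {α : ℝ} (hα : 0 < α)
    (hαQ : α ≤ alphaQ d L) {U₀ : Site d → Fin d → 𝔸ˣ} (hU₀ : ∀ x κ, U₀ x κ ∈ unitaryUnits 𝔸) (hreg : Reg17 L m Ω α U₀)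
    {j : ℕ} (hj : j ≤ m) (z : Site d) (κ : Fin d) (hbox : ∀ x, InBox (loK L j z) (bondHiK L j z κ) x → x ∈ Ω j)
    (y : Site d) (μ : Fin d) (X : 𝔸) :
    ‖linCovIter L U₀ (bump y μ X) j z κ‖ ≤ (1 + thetaGen d L α) * ((L : ℝ) ^ j * (((L : ℝ) ^ j) ^ d)⁻¹) * ‖X‖ := by
  have hL1 : 1 ≤ L := le_trans (by norm_num) hL
  obtain ⟨hUG, hpdev, hag⟩ := clamp_data hL1 hα hU₀ hreg hj z κ hbox
  -- the three windows at `α ≤ α_Q`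
  have hα3 : C0 d * α ≤ 1 / 3 := (mul_le_mul_of_nonneg_left hαQ (C0_pos d).le).trans (C0_mul_alphaQ_le d L)
  have hα4 : 4 * α ≤ c2' d L := by linarith [four_mul_alphaQ_le d L]
  have h145 : 8 * d * thetaGen d L α * (L : ℝ)⁻¹ ^ 4 ≤ 1 := by
    refine le_trans ?_ (h145_alphaQ d hL1)
    have : thetaGen d L α ≤ thetaGen d L (alphaQ d L) := by
      unfold thetaGen; exact mul_le_mul_of_nonneg_left hαQ (by positivity)
    have hd : (0 : ℝ) ≤ d := Nat.cast_nonneg d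
    exact mul_le_mul_of_nonneg_right (mul_le_mul_of_nonneg_left this (by positivity)) (by positivity)
  -- the global (147) for the clamped extension, depth `k := j`
  have key := (prop5_general_147 L hL (avgClosed_unitaryUnits d L) j _ hUG hα hα3 hα4 hpdev h145 y μ X le_rfl z κ).1
  have hs : (L : ℝ) ^ j * ((L : ℝ) ^ j)⁻¹ = 1 := mul_inv_cancel₀ (by positivity)
  rw [hs, one_pow, mul_one] at key
  -- transport back by locality
  rwa [linCovIter_congr L hL1 j z κ hag (fun _ _ _ _ => rfl)] at key

omit [Nontrivial 𝔸] in
/-- `LʲηQ_j(U₀)0 = 0` (every one-step linear part is a derivative of a constant). [cite: Balaban1985Averaging, (127) p.37] -/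
private theorem linCovIter_zero_fun (L : ℕ) (U₀ : Site d → Fin d → 𝔸ˣ) : ∀ j : ℕ, linCovIter L U₀ (0 : Site d → Fin d → 𝔸) j = 0
  | 0 => rfl
  | j + 1 => by
    funext z κ
    rw [linCovIter_succ, linCovIter_zero_fun L U₀ j]
    simp [linQcov]

omit [Nontrivial 𝔸] in
/-- the restriction of a bond field to a finite bond set is the finite sum of its single-bond pieces. [folklore] -/
private theorem insCfg_restr_eq_sum (S : Finset (Site d × Fin d)) (B : Site d → Fin d → 𝔸) :
    insCfg S (restr S B) = (0 : Site d → Fin d → 𝔸) + ∑ s ∈ S, (1 : ℂ) • bump s.1 s.2 (B s.1 s.2) := by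
  classical
  funext x κ
  rw [zero_add, Finset.sum_apply, Finset.sum_apply]
  simp only [Pi.smul_apply, one_smul, bump, insCfg, restr]
  by_cases h : (x, κ) ∈ S
  · rw [dif_pos h, Finset.sum_eq_single (x, κ)]
    · simp
    · rintro ⟨x', κ'⟩ _ hne
      rw [if_neg]
      rintro ⟨rfl, rfl⟩
      exact hne rfl
    · intro hn; exact absurd h hn
  · rw [dif_neg h]
    symm
    refine Finset.sum_eq_zero fun s hs => ?_
    rw [if_neg]
    rintro ⟨rfl, rfl⟩
    exact h hs

/-- ★ **THE ROW SUM — `LʲηQ_j(U₀)` IS BOUNDED ON BOUNDED FIELDS AT A BOND OF `Λ_j`**: under the hypotheses of `norm_linCovIter_bump_le_of_reg17`,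
for a bond field `B` with `‖B(b)‖ ≤ β` on the box, `‖LʲηQ_j(U₀)B(c)‖ ≤ 2d·(1 + θ(α))·Lʲ·β` («|Q_j(U₀)A| ≦ … Q″_j|A|» summed over the
`2d·L^{jd}` bonds of the box: locality + additivity of the composite in the regime, `B7Prop5LineDerivFiniteFamily.linCovIter_family`, + the
column bound). [cite: Balaban1985Averaging, (143)–(147) pp.39–40, (141) p.39] -/
theorem norm_linCovIter_le_of_reg17 {L : ℕ} (hL : 2 ≤ L) {m : ℕ} {Ω : ℕ → Set (Site d)} {α : ℝ} (hα : 0 < α)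
    (hαQ : α ≤ alphaQ d L) {U₀ : Site d → Fin d → 𝔸ˣ} (hU₀ : ∀ x κ, U₀ x κ ∈ unitaryUnits 𝔸) (hreg : Reg17 L m Ω α U₀)
    {j : ℕ} (hj : j ≤ m) (z : Site d) (κ : Fin d) (hbox : ∀ x, InBox (loK L j z) (bondHiK L j z κ) x → x ∈ Ω j)
    (B : Site d → Fin d → 𝔸) {β : ℝ} (hβ : 0 ≤ β) (hB : ∀ y μ, BondIn (loK L j z) (bondHiK L j z κ) y μ → ‖B y μ‖ ≤ β) :
    ‖linCovIter L U₀ B j z κ‖ ≤ 2 * d * ((1 + thetaGen d L α) * (L : ℝ) ^ j) * β := by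
  classical
  have hL1 : 1 ≤ L := le_trans (by norm_num) hL
  obtain ⟨hUG, hpdev, hag⟩ := clamp_data hL1 hα hU₀ hreg hj z κ hbox
  have hα3 : C0 d * α ≤ 1 / 3 := (mul_le_mul_of_nonneg_left hαQ (C0_pos d).le).trans (C0_mul_alphaQ_le d L)
  have hα4 : 4 * α ≤ c2' d L := by linarith [four_mul_alphaQ_le d L]
  set U' := clampCfg (loK L j z) (bondHiK L j z κ) U₀ with hU'
  set S := bondsIn (loK L j z) (bondHiK L j z κ) with hS
  -- transport to the clamped background and the restricted field
  have hloc : linCovIter L U₀ B j z κ = linCovIter L U' (insCfg S (restr S B)) j z κ :=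
    linCovIter_congr L hL1 j z κ hag.symm (agreeOn_insCfg_restr _ _ B)
  rw [hloc, insCfg_restr_eq_sum S B,
    linCovIter_family L U' j (hadd_levels L hL (avgClosed_unitaryUnits d L) j U' hUG hα hα3 hα4 hpdev)
      (hsmul_levels L hL (avgClosed_unitaryUnits d L) j U' hUG hα hα3 hα4 hpdev) S (fun _ => (1 : ℂ))
      (fun s => bump s.1 s.2 (B s.1 s.2)) 0 j le_rfl z κ,
    linCovIter_zero_fun, Pi.zero_apply, Pi.zero_apply, zero_add]
  -- column bounds, summed over the `≤ 2d·L^{jd}` bonds of the box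
  have hθ0 : 0 ≤ 1 + thetaGen d L α := by unfold thetaGen; positivity
  have hcol : ∀ s ∈ S, ‖(1 : ℂ) • linCovIter L U' (bump s.1 s.2 (B s.1 s.2)) j z κ‖ ≤
      (1 + thetaGen d L α) * ((L : ℝ) ^ j * (((L : ℝ) ^ j) ^ d)⁻¹) * β := by
    intro s hs
    rw [one_smul]
    have hb := hB s.1 s.2 (mem_bondsIn.1 hs)
    -- the column bound at the CLAMPED background (global regime) read back at `U₀` by locality is the same column; use it at `U₀`
    have h := norm_linCovIter_bump_le_of_reg17 hL hα hαQ hU₀ hreg hj z κ hbox s.1 s.2 (B s.1 s.2)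
    rw [linCovIter_congr L hL1 j z κ hag.symm (fun _ _ _ _ => rfl)] at h
    exact h.trans (mul_le_mul_of_nonneg_left hb (by positivity))
  have hcard : (S.card : ℝ) ≤ 2 * ((L : ℝ) ^ j) ^ d * d := by
    have h1 := card_bondsIn_le (loK L j z) (bondHiK L j z κ)
    rw [card_boxFinset_K] at h1
    have : (S.card : ℝ) ≤ ((2 * (L ^ j) ^ d * d : ℕ) : ℝ) := by exact_mod_cast h1
    simpa using this
  calc ‖∑ s ∈ S, (1 : ℂ) • linCovIter L U' (bump s.1 s.2 (B s.1 s.2)) j z κ‖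
      ≤ ∑ s ∈ S, ‖(1 : ℂ) • linCovIter L U' (bump s.1 s.2 (B s.1 s.2)) j z κ‖ := norm_sum_le _ _
    _ ≤ ∑ s ∈ S, (1 + thetaGen d L α) * ((L : ℝ) ^ j * (((L : ℝ) ^ j) ^ d)⁻¹) * β := Finset.sum_le_sum hcol
    _ = S.card * ((1 + thetaGen d L α) * ((L : ℝ) ^ j * (((L : ℝ) ^ j) ^ d)⁻¹) * β) := by
        rw [Finset.sum_const, nsmul_eq_mul]
    _ ≤ (2 * ((L : ℝ) ^ j) ^ d * d) * ((1 + thetaGen d L α) * ((L : ℝ) ^ j * (((L : ℝ) ^ j) ^ d)⁻¹) * β) :=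
        mul_le_mul_of_nonneg_right hcard (by positivity)
    _ = 2 * d * ((1 + thetaGen d L α) * (L : ℝ) ^ j) * β := by
        have hP : ((L : ℝ) ^ j) ^ d ≠ 0 := by positivity
        field_simp

end Regime


/-! ## §4 The genuine averaging letter `Q*aQ` on the `ℤᵈ × 𝔸` carrier and the binder `AvgAtP` PROVED for it -/

section Letter

open B7Prop1Explicit (e)
open B7Prop1Local (InBox loK bondHiK)
open B7Prop2Explicit (unitaryUnits)
open B7Prop5Flat (BondIn bump)
open B7Prop4GeneralLevels (linCovIter)
open B7Prop5GeneralLevels (thetaGen)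
open B8Ineq132 (InAk BondTouches)
open B8Eq140Level (SideTouches sideTouches_of_bondTouches)
open B8Eq146AExpansion (iEta norm_iEta_le)
open B8Eq155JBound (wsup wsup_le le_wsup wsup_nonneg)
open B8ScaledSupNorm (msup Bdd msup_nonneg norm_le_of_msup_le)
open B8LeafModelZd (ZdIdx)
open B9SupplySockB9P3ZdLetters (OpsZd)
open B9SupplySockB9P3ZdLettersOmega (OnDom)
open B9SupplySockB9P3ZdAt (AvgAt)
open B9SupplySockB9P3ZdGammaUniv (AvgAtP avgAtP_self)

variable (τ : 𝔸 →ₗ[ℂ] ℂ) [FiniteDimensional ℝ 𝔸] (L : ℕ)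

omit [FiniteDimensional ℝ 𝔸] in
/-- **THE LEVEL WEIGHT of `Q*aQ` in B8's normalisation**: `w_j = (Lʲη)⁻³·L^{jd}·L^{−j}` — (3.16)'s `(Lʲη)⁻²`, times `(Lʲη)⁻¹` converting
`Q_j(U₀)A` into the un-normalised composite `LʲηQ_j(U₀)A` of the tree ([B8] (1.56) «LʲηQ_jA = B₁», (1.58) «Σ_jQ*_jΛ_j(Lʲη)⁻³B₁»), times `L^{jd}L^{−j}`
converting print's adjoint `Q*_j` (weights `η^d`, `(Lʲη)^d` of (3.16)–(3.17)) of the true average `Q_j = L^{−j}·(LʲQ_j)` into the plain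
fibre-transpose `Q_jᵀ` of the composite. [cite: Balaban1985BackgroundPropagators, (3.16)–(3.17) p.393; Balaban1985RegularSpaces, (1.56), (1.58) p.86] -/
def wQ (η : ℝ) (j : ℕ) : ℝ := ((((L : ℝ) ^ j * η) ^ 3)⁻¹) * ((((L : ℝ) ^ j) ^ d) * ((L : ℝ) ^ j)⁻¹)

omit [FiniteDimensional ℝ 𝔸] in
/-- `w_j ≥ 0`. [folklore] -/
private theorem wQ_nonneg {η : ℝ} (hη : 0 ≤ η) (j : ℕ) : 0 ≤ wQ (d := d) L η j := by
  unfold wQ; positivity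

omit [FiniteDimensional ℝ 𝔸] in
open Classical in
/-- **THE LEVEL-`j` INPUT OF `Q*_j`**: `𝟙_{Λ_j}·(LʲηQ_j(U₀)A)` with `Λ_j = ΛbP m j` the supplied averaging class and the factor `−i` undoing the `i`
of the tree's exponent variable `B = iηA` (`iEta`) — print's `Λ_jQ_j` applied to `A`, in the un-normalised currency. [cite: Balaban1985BackgroundPropagators, (3.16) p.393; Balaban1985RegularSpaces, (1.56) p.86] -/
def clsField (ΛbP : ℕ → ℕ → Set (Site d × Fin d)) (η : ℝ) (m j : ℕ) (U₀ : Site d → Fin d → 𝔸ˣ) (A : Site d → Fin d → 𝔸) :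
    Site d → Fin d → 𝔸 :=
  fun z κ => if (z, κ) ∈ ΛbP m j then (-Complex.I : ℂ) • linCovIter L U₀ (iEta η A) j z κ else 0

open Classical in
/-- ★★ **THE GENUINE AVERAGING LETTER `Q*aQ` OF [B9] (3.16) ON THE `ℤᵈ × 𝔸` CARRIER** (B8's normalisation (1.58), `a = 1`), at the member
`(i, m)` with averaging class `ΛbP`:  `(Q*aQ A)(b) = Σ_{j ≤ m} w_j · (Q_jᵀ(𝟙_{Λ_j}·LʲηQ_j(U₀)A))(b)` = print's `Σ_j (Lʲη)⁻²(Q*_jΛ_jQ_j A)(b)`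
(`Q*_j = L^{jd}Q_jᵀ` the adjoint for the weights of (3.16)–(3.17), `Q_j = L^{−j}(LʲQ_j)`), ON PRINT'S CLASS (1.7) of backgrounds `U₀ ∈ 𝔄` at the
window `α_Q(d, L)` (`Reg17`) — where [5]'s averaging operators are defined and estimated —, and `0` off that class (a total letter; [5] Prop. 3
defines `Q(V₀, ·)` for regular `V₀` only).  Fills the `QQ` slot of `B9SupplySockB9P3ZdLetters.OpsZd`. [cite: Balaban1985BackgroundPropagators, (3.16) p.393, (3.26) p.395; Balaban1985RegularSpaces, (1.56), (1.58) p.86, (1.7) p.77; Balaban1985Averaging, (127) p.37, Prop. 3 p.36] -/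
def QQZd (ΛbP : ℕ → ℕ → Set (Site d × Fin d)) (i : ZdIdx d L) (m : ℕ) (U₀ : Site d → Fin d → 𝔸ˣ) (A : Site d → Fin d → 𝔸) :
    Site d → Fin d → 𝔸 :=
  fun y μ => if Reg17 L m i.Ω (alphaQ d L) U₀ then
      ∑ j ∈ Finset.range (m + 1), (wQ (d := d) L i.η j) • linCovIterT τ L U₀ j (clsField L ΛbP i.η m j U₀ A) y μ
    else 0

/-- **THE LETTER FAMILY WITH THE GENUINE `Q*aQ`**: `ops₀` with its `QQ` field replaced by `QQZd` at every member (the other three letters —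
`Gop`, `Dp`, `DRDs` — untouched; the pattern of `B9Eq321LandauProjectionZd.opsLandau` ∕ `B9SupplySockB9P3ZdGammaInAkDpZd.withDpZd`).
[cite: Balaban1985BackgroundPropagators, (3.26) p.395, (3.16) p.393] -/
def withQQ (ΛbP : ℕ → ℕ → Set (Site d × Fin d)) (ops₀ : ℝ → ZdIdx d L → ℕ → OpsZd d 𝔸) :
    ℝ → ZdIdx d L → ℕ → OpsZd d 𝔸 :=
  fun M i m => { ops₀ M i m with QQ := QQZd τ L ΛbP i m }

/-- the replaced field, unfolded. [cite: Balaban1985BackgroundPropagators, (3.16) p.393 (bookkeeping)] -/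
@[simp] theorem withQQ_QQ (ΛbP : ℕ → ℕ → Set (Site d × Fin d)) (ops₀ : ℝ → ZdIdx d L → ℕ → OpsZd d 𝔸) (M : ℝ) (i : ZdIdx d L) (m : ℕ) :
    (withQQ τ L ΛbP ops₀ M i m).QQ = QQZd τ L ΛbP i m := rfl

/-- the untouched fields. [cite: Balaban1985BackgroundPropagators, (3.26) p.395 (bookkeeping)] -/
@[simp] theorem withQQ_Gop (ΛbP : ℕ → ℕ → Set (Site d × Fin d)) (ops₀ : ℝ → ZdIdx d L → ℕ → OpsZd d 𝔸) (M : ℝ) (i : ZdIdx d L) (m : ℕ) :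
    (withQQ τ L ΛbP ops₀ M i m).Gop = (ops₀ M i m).Gop := rfl

/-- the untouched fields. [cite: Balaban1985BackgroundPropagators, (3.26) p.395 (bookkeeping)] -/
@[simp] theorem withQQ_Dp (ΛbP : ℕ → ℕ → Set (Site d × Fin d)) (ops₀ : ℝ → ZdIdx d L → ℕ → OpsZd d 𝔸) (M : ℝ) (i : ZdIdx d L) (m : ℕ) :
    (withQQ τ L ΛbP ops₀ M i m).Dp = (ops₀ M i m).Dp := rfl

/-- the untouched fields. [cite: Balaban1985BackgroundPropagators, (3.26) p.395 (bookkeeping)] -/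
@[simp] theorem withQQ_DRDs (ΛbP : ℕ → ℕ → Set (Site d × Fin d)) (ops₀ : ℝ → ZdIdx d L → ℕ → OpsZd d 𝔸) (M : ℝ) (i : ZdIdx d L) (m : ℕ) :
    (withQQ τ L ΛbP ops₀ M i m).DRDs = (ops₀ M i m).DRDs := rfl

/-- on the class (1.7) the letter is the genuine sum. [cite: Balaban1985BackgroundPropagators, (3.16) p.393] -/
theorem QQZd_of_reg17 {ΛbP : ℕ → ℕ → Set (Site d × Fin d)} {i : ZdIdx d L} {m : ℕ} {U₀ : Site d → Fin d → 𝔸ˣ}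
    (h : Reg17 L m i.Ω (alphaQ d L) U₀) (A : Site d → Fin d → 𝔸) (y : Site d) (μ : Fin d) :
    QQZd τ L ΛbP i m U₀ A y μ =
      ∑ j ∈ Finset.range (m + 1), (wQ (d := d) L i.η j) • linCovIterT τ L U₀ j (clsField L ΛbP i.η m j U₀ A) y μ := by
  simp [QQZd, h]

/-- off the class (1.7) the letter is `0`. [cite: Balaban1985Averaging, Prop. 3 p.36 (the averaging is defined for regular backgrounds)] -/
theorem QQZd_of_not_reg17 {ΛbP : ℕ → ℕ → Set (Site d × Fin d)} {i : ZdIdx d L} {m : ℕ} {U₀ : Site d → Fin d → 𝔸ˣ}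
    (h : ¬ Reg17 L m i.Ω (alphaQ d L) U₀) (A : Site d → Fin d → 𝔸) (y : Site d) (μ : Fin d) :
    QQZd τ L ΛbP i m U₀ A y μ = 0 := by
  simp [QQZd, h]

/-- **THE LETTER IS PRINT'S AT EVERY SOCKET DATUM**: a background in `𝔄_k({Ω_j}, α₀)` (`InAk`) with `α₀ ≤ α_Q(d, L)` is in the class, so there
`QQZd` is the genuine sum (no junk branch at the data the suppliers are applied to). [cite: Balaban1985RegularSpaces, (1.7) p.77, (1.33)–(1.35) p.82] -/
theorem QQZd_of_inAk {ΛbP : ℕ → ℕ → Set (Site d × Fin d)} {i : ZdIdx d L} {m : ℕ} (hm : m ≤ i.k) {α₀ : ℝ} (hα₀ : α₀ ≤ alphaQ d L)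
    {U₀ : Site d → Fin d → 𝔸ˣ} (hU₀ : InAk L i.k i.η α₀ i.Ω U₀) (A : Site d → Fin d → 𝔸) (y : Site d) (μ : Fin d) :
    QQZd τ L ΛbP i m U₀ A y μ =
      ∑ j ∈ Finset.range (m + 1), (wQ (d := d) L i.η j) • linCovIterT τ L U₀ j (clsField L ΛbP i.η m j U₀ A) y μ :=
  QQZd_of_reg17 τ L (reg17_mono hα₀ (reg17_of_inAk hU₀ hm)) A y μ

omit [FiniteDimensional ℝ 𝔸] in
/-- **THE CLASS LAW** under which the averaging binder holds for the genuine letter (print's (1.31) collars ∕ [B6] (2.1)–(2.2)): every site `y` of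
the box `Bʲ(c₋) ∪ Bʲ(c₊)` of a level-`j` class bond `c ∈ Λ_j` lies in `Ω_j` («Λ_j ⊂ Ω_j^{(j)}», (1.5)), and a unit-lattice bond at `y` touches `Ω_i`
only for `i ≤ j + s` (the domains `Ω_{j+s+1} ⊂ … ` keep a collar off the class boxes of level `j`).  DISPLAYED, to be derived by the law owners
for their class (`towerBondsP`). [cite: Balaban1985RegularSpaces, (1.5) p.77, (1.28)–(1.31) pp.81–82; Balaban1984PropagatorsII, (2.1)–(2.3) p.224] -/
def LevelSepP (L m : ℕ) (Ω : ℕ → Set (Site d)) (ΛbP : ℕ → ℕ → Set (Site d × Fin d)) (s : ℕ) : Prop :=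
  ∀ j, j ≤ m → ∀ c ∈ ΛbP m j, ∀ y, InBox (loK L j c.1) (bondHiK L j c.1 c.2) y →
    y ∈ Ω j ∧ ∀ i', i' ≤ m → ∀ μ : Fin d, BondTouches (Ω i') y μ → i' ≤ j + s

/-- **THE CONSTANT `q` OF THE AVERAGING BINDER** for the genuine letter: `q = 4d·C_τ·β_τ·(1 + θ(α_Q))·L^{3s}`. [cite: Balaban1985RegularSpaces, (1.58)–(1.59) p.86; Balaban1985Averaging, (147) p.40] -/
def qQ (d L : ℕ) (Cτ βτ : ℝ) (s : ℕ) : ℝ := 4 * d * Cτ * βτ * (1 + thetaGen d L (alphaQ d L)) * ((L : ℝ) ^ 3) ^ s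

omit [CStarAlgebra 𝔸] [FiniteDimensional ℝ 𝔸] in
/-- in dimension `d ≥ 2` every direction has another one. [folklore] -/
private theorem exists_ne_dir (hd : 2 ≤ d) (μ : Fin d) : ∃ κ : Fin d, κ ≠ μ := by
  by_cases h : (μ : ℕ) = 0
  · exact ⟨⟨1, by omega⟩, fun hk => by have := congrArg Fin.val hk; simp at this; omega⟩
  · exact ⟨⟨0, by omega⟩, fun hk => by have := congrArg Fin.val hk; simp at this; omega⟩

omit [CStarAlgebra 𝔸] [FiniteDimensional ℝ 𝔸] in
/-- the finite geometric bound behind the `m`-uniformity of `q`: `Σ_{j ≤ m, j₀ ≤ j+s} (L³)^s·(L⁻³)^{j+s−j₀} ≤ 2(L³)^s` (`L ≥ 2`). [folklore] -/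
private theorem level_sum_le {L : ℕ} (hL : 2 ≤ L) (m j₀ s : ℕ) :
    ∑ j ∈ Finset.range (m + 1),
        (if j₀ ≤ j + s then ((L : ℝ) ^ 3) ^ s * (((L : ℝ) ^ 3)⁻¹) ^ (j + s - j₀) else 0)
      ≤ 2 * ((L : ℝ) ^ 3) ^ s := by
  classical
  have hL' : (2 : ℝ) ≤ L := by exact_mod_cast hL
  set r : ℝ := ((L : ℝ) ^ 3)⁻¹ with hr
  have hL3 : (8 : ℝ) ≤ (L : ℝ) ^ 3 := by
    have h := pow_le_pow_left₀ (by norm_num : (0 : ℝ) ≤ 2) hL' 3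
    norm_num at h
    exact h
  have hr0 : 0 ≤ r := by rw [hr]; positivity
  have hr1 : r ≤ 1 / 2 := by
    rw [hr, inv_le_comm₀ (by positivity) (by norm_num)]
    linarith
  have hP : 0 ≤ ((L : ℝ) ^ 3) ^ s := by positivity
  -- restrict to the levels that count and re-index by `n = j + s − j₀`
  set S := (Finset.range (m + 1)).filter (fun j => j₀ ≤ j + s) with hS
  have hsum : ∑ j ∈ Finset.range (m + 1),
        (if j₀ ≤ j + s then ((L : ℝ) ^ 3) ^ s * r ^ (j + s - j₀) else 0)
      = ((L : ℝ) ^ 3) ^ s * ∑ j ∈ S, r ^ (j + s - j₀) := by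
    rw [hS, Finset.sum_filter, Finset.mul_sum]
    refine Finset.sum_congr rfl fun j _ => ?_
    split_ifs <;> simp
  rw [hsum, mul_comm (2 : ℝ)]
  refine mul_le_mul_of_nonneg_left ?_ hP
  -- `j ↦ j + s − j₀` is injective on `S`, with values `< m + 1 + s`
  have hinj : Set.InjOn (fun j => j + s - j₀) (S : Set ℕ) := by
    intro a ha b hb hab
    simp only [hS, Finset.coe_filter, Finset.mem_range, Set.mem_setOf_eq] at ha hb
    simp only at hab
    omega
  calc ∑ j ∈ S, r ^ (j + s - j₀) = ∑ n ∈ S.image (fun j => j + s - j₀), r ^ n := (Finset.sum_image hinj).symm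
    _ ≤ ∑ n ∈ Finset.range (m + 1 + s), r ^ n := by
        refine Finset.sum_le_sum_of_subset_of_nonneg (fun n hn => ?_) (fun n _ _ => by positivity)
        simp only [Finset.mem_image, hS, Finset.mem_filter, Finset.mem_range] at hn
        obtain ⟨j, ⟨hj, hj'⟩, rfl⟩ := hn
        simp only [Finset.mem_range]
        omega
    _ = ∑ n ∈ Finset.Ico 0 (m + 1 + s), r ^ n := by rw [Finset.range_eq_Ico]
    _ ≤ r ^ 0 / (1 - r) := geom_sum_Ico_le_of_lt_one hr0 (by linarith)
    _ ≤ 2 := by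
        rw [pow_zero, div_le_iff₀ (by linarith)]
        linarith

variable [Nontrivial 𝔸]

set_option maxHeartbeats 400000 in
/-- ★★★ **THE AVERAGING BINDER `AvgAtP` PROVED FOR THE GENUINE LETTER** — [B9] (3.16) with [B8] (1.56)∕(1.58): for EVERY member `i`, truncation
`m ≤ i.k`, block parameter `M`, base letters `ops₀` and every averaging class `ΛbP` obeying the law `LevelSepP L m i.Ω ΛbP s`,
`B9SupplySockB9P3ZdGammaUniv.AvgAtP L (withQQ τ L ΛbP ops₀) q ΛbP M i m` holds at `q = qQ d L C_τ β_τ s = 4d·C_τ·β_τ·(1+θ(α_Q))·L^{3s}`: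
at every unitary `U₀`, every `A ∈ E(Ω₀)` (`OnDom`), every `j₀ ≤ m` and bond `b` touching `Ω_{j₀}`, `(L^{j₀}η)³‖(Q*aQ A)(b)‖ ≤ q·|B₁|(A)`.
PROOF: off the class (1.7) the letter is `0`; on it, each level `j` contributes the fibre-transposed columns of `LʲηQ_j(U₀)` at the `≤ 2d` window bonds
— bounded by [5] Prop. 5 (147) localised to the class boxes (`norm_linCovIter_bump_le_of_reg17`) —, applied to `𝟙_{Λ_j}LʲηQ_jA`, each value below
`|B₁|` (the `wsup` is attained: the averaged family is bounded by the row sum `norm_linCovIter_le_of_reg17` and `A ∈ E(Ω₀)` is bounded); the weights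
collapse to `L^{3(j₀−j)}` with `j₀ ≤ j + s` by the class law, and the level sum is geometric.  `d ≥ 2`, `L ≥ 2`; `𝔸` finite-dimensional over `ℝ`,
`|Re τ(x*y)| ≤ C_τ‖x‖‖y‖` (NO faithfulness and NO `m ≤ i.k` are used by the BOUND; faithfulness is what makes the letter the genuine transpose,
`tauForm_entryT`); every binder hypothesis of `AvgAtP` (unitary `U₀`, `A ∈ E(Ω₀)`) is used as printed. [cite: Balaban1985BackgroundPropagators, (3.16) p.393, (3.26)–(3.27) p.395; Balaban1985RegularSpaces, (1.56), (1.58)–(1.59) p.86, (1.7) p.77, (1.31) p.82; Balaban1985Averaging, (147) p.40, Prop. 5 p.42] -/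
theorem avgAtP_withQQ (hd : 2 ≤ d) (hL : 2 ≤ L)
    {Cτ : ℝ} (hCτ : ∀ x y : 𝔸, |(τ (star x * y)).re| ≤ Cτ * ‖x‖ * ‖y‖)
    (ΛbP : ℕ → ℕ → Set (Site d × Fin d)) (ops₀ : ℝ → ZdIdx d L → ℕ → OpsZd d 𝔸) (M : ℝ) (i : ZdIdx d L)
    (m : ℕ) {s : ℕ} (hlaw : LevelSepP L m i.Ω ΛbP s) :
    AvgAtP L (withQQ τ L ΛbP ops₀) (qQ d L Cτ (betaTau τ) s) ΛbP M i m := by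
  classical
  intro U₀ hU₀ A hOn j₀ hj₀ y μ htouch
  have hL1 : 1 ≤ L := le_trans (by norm_num) hL
  have hL0 : (0 : ℝ) < L := by exact_mod_cast (lt_of_lt_of_le (by norm_num) hL)
  have hη := i.hη
  have hCτ0 : 0 ≤ Cτ := by
    have h := hCτ 1 1
    simp only [norm_one, mul_one] at h
    exact (abs_nonneg _).trans h
  have hβτ := betaTau_nonneg τ
  have hθpos : 0 < 1 + thetaGen d L (alphaQ d L) := by
    have := alphaQ_pos d hL1; unfold thetaGen; positivity
  have hθ0 : 0 ≤ 1 + thetaGen d L (alphaQ d L) := hθpos.le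
  -- the right-hand side
  set W := wsup 1 (fun p : {p : ℕ × (Site d × Fin d) // p.1 ≤ m ∧ p.2 ∈ ΛbP m p.1} =>
      linCovIter L U₀ (iEta i.η A) p.1.1 p.1.2.1 p.1.2.2) with hW
  have hW0 : 0 ≤ W := wsup_nonneg zero_le_one _
  have hq0 : 0 ≤ qQ d L Cτ (betaTau τ) s := by unfold qQ; positivity
  show ((L : ℝ) ^ j₀ * i.η) ^ 3 * ‖QQZd τ L ΛbP i m U₀ A y μ‖ ≤ qQ d L Cτ (betaTau τ) s * W
  by_cases hreg : Reg17 L m i.Ω (alphaQ d L) U₀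
  swap
  · rw [QQZd_of_not_reg17 τ L hreg, norm_zero, mul_zero]; positivity
  rw [QQZd_of_reg17 τ L hreg]
  -- (1) `A ∈ E(Ω₀)` is bounded, hence so is `iηA`
  obtain ⟨β, hβ0, hAβ⟩ : ∃ β : ℝ, 0 ≤ β ∧ ∀ z ν, ‖iEta i.η A z ν‖ ≤ β := by
    set c := msup L m i.η (-(1 : ℝ)) (fun j (b : Site d × Fin d) => SideTouches (i.Ω j) b.1 b.2) (fun b => A b.1 b.2)
      with hc
    have hc0 : 0 ≤ c := msup_nonneg L m hη.le _ _ _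
    refine ⟨i.η * (c * (((L : ℝ) ^ 0 * i.η) ^ (-(1 : ℝ)))), by positivity, fun z ν => norm_iEta_le hη.le (fun z ν => ?_) z ν⟩
    by_cases hb : BondTouches (i.Ω 0) z ν
    · obtain ⟨κ, hκ⟩ := exists_ne_dir hd ν
      exact norm_le_of_msup_le (F := fun b : Site d × Fin d => A b.1 b.2) hL1 hη hOn.2 le_rfl (Nat.zero_le m)
        (i := (z, ν)) (sideTouches_of_bondTouches hκ hb)
    · rw [hOn.1 z ν hb, norm_zero]; positivity
  -- (2) the averaged family over the class bonds is bounded (row sums), so each member is below `W`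
  have hbox : ∀ j, j ≤ m → ∀ c ∈ ΛbP m j, ∀ x, InBox (loK L j c.1) (bondHiK L j c.1 c.2) x → x ∈ i.Ω j :=
    fun j hj c hc x hx => (hlaw j hj c hc x hx).1
  have hB1 : ∀ j, j ≤ m → ∀ c ∈ ΛbP m j, ‖linCovIter L U₀ (iEta i.η A) j c.1 c.2‖ ≤ W := by
    intro j hj c hc
    have hbd : ∀ p : {p : ℕ × (Site d × Fin d) // p.1 ≤ m ∧ p.2 ∈ ΛbP m p.1},
        1 * ‖linCovIter L U₀ (iEta i.η A) p.1.1 p.1.2.1 p.1.2.2‖ ≤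
          2 * d * ((1 + thetaGen d L (alphaQ d L)) * (L : ℝ) ^ m) * β := by
      intro p
      rw [one_mul]
      refine (norm_linCovIter_le_of_reg17 hL (alphaQ_pos d hL1) le_rfl hU₀ hreg p.2.1 p.1.2.1 p.1.2.2
        (hbox _ p.2.1 _ p.2.2) _ hβ0 (fun z ν _ => hAβ z ν)).trans ?_
      have hpow : (L : ℝ) ^ p.1.1 ≤ (L : ℝ) ^ m := pow_le_pow_right₀ (by exact_mod_cast hL1) p.2.1
      have hd0 : (0 : ℝ) ≤ d := Nat.cast_nonneg d
      exact mul_le_mul_of_nonneg_right (mul_le_mul_of_nonneg_left (mul_le_mul_of_nonneg_left hpow hθ0) (by positivity)) hβ0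
    have h := le_wsup hbd ⟨(j, c), hj, hc⟩
    rwa [one_mul] at h
  -- (3) the level-`j` term
  set C : ℝ := 2 * d * (Cτ * betaTau τ * (1 + thetaGen d L (alphaQ d L))) with hC
  have hC0 : 0 ≤ C := by positivity
  have hlevel : ∀ j ∈ Finset.range (m + 1),
      ((L : ℝ) ^ j₀ * i.η) ^ 3 * ‖(wQ (d := d) L i.η j) • linCovIterT τ L U₀ j (clsField L ΛbP i.η m j U₀ A) y μ‖ ≤
        C * W * (if j₀ ≤ j + s then ((L : ℝ) ^ 3) ^ s * (((L : ℝ) ^ 3)⁻¹) ^ (j + s - j₀) else 0) := by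
    intro j hjm
    rw [Finset.mem_range] at hjm
    have hj : j ≤ m := by omega
    -- the column bound at the window bonds carrying class values
    have hK0 : 0 ≤ (1 + thetaGen d L (alphaQ d L)) * ((L : ℝ) ^ j * (((L : ℝ) ^ j) ^ d)⁻¹) := by positivity
    have hcol : ∀ (κ : Fin d) (t : Fin 2), clsField L ΛbP i.η m j U₀ A (winBase L j y κ t) κ ≠ 0 →
        ∀ X : 𝔸, ‖linCovIter L U₀ (bump y μ X) j (winBase L j y κ t) κ‖ ≤
          (1 + thetaGen d L (alphaQ d L)) * ((L : ℝ) ^ j * (((L : ℝ) ^ j) ^ d)⁻¹) * ‖X‖ := by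
      intro κ t hne X
      have hmem : (winBase L j y κ t, κ) ∈ ΛbP m j := by
        by_contra hn; exact hne (by simp [clsField, hn])
      exact norm_linCovIter_bump_le_of_reg17 hL (alphaQ_pos d hL1) le_rfl hU₀ hreg hj _ κ
        (hbox j hj _ hmem) y μ X
    have hT := norm_linCovIterT_le τ hCτ L U₀ j (clsField L ΛbP i.η m j U₀ A) y μ hK0 hcol
    -- the class values are below `W`, and vanish off the class
    have hval : ∀ (κ : Fin d) (t : Fin 2), ‖clsField L ΛbP i.η m j U₀ A (winBase L j y κ t) κ‖ ≤
        if (winBase L j y κ t, κ) ∈ ΛbP m j then W else 0 := by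
      intro κ t
      unfold clsField
      split_ifs with hmem
      · rw [norm_smul, norm_neg, Complex.norm_I, one_mul]
        exact hB1 j hj _ hmem
      · rw [norm_zero]
    by_cases hP : ∃ (κ : Fin d) (t : Fin 2), (winBase L j y κ t, κ) ∈ ΛbP m j
    · -- some window bond is a class bond: the class law gives `j₀ ≤ j + s`
      obtain ⟨κ₀, t₀, hmem₀⟩ := hP
      have hsep : j₀ ≤ j + s := (hlaw j hj _ hmem₀ y (inBox_winBase hL1 j y κ₀ t₀)).2 j₀ hj₀ μ htouch
      rw [if_pos hsep]
      have hsumW : ∑ κ : Fin d, ∑ t : Fin 2, ‖clsField L ΛbP i.η m j U₀ A (winBase L j y κ t) κ‖ ≤ 2 * d * W := by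
        calc ∑ κ : Fin d, ∑ t : Fin 2, ‖clsField L ΛbP i.η m j U₀ A (winBase L j y κ t) κ‖
            ≤ ∑ κ : Fin d, ∑ t : Fin 2, W :=
              Finset.sum_le_sum fun κ _ => Finset.sum_le_sum fun t _ => (hval κ t).trans (by split_ifs <;> linarith)
          _ = 2 * d * W := by simp [Finset.sum_const, Finset.card_univ, Fintype.card_fin]; ring
      -- weights: `(L^{j₀}η)³ · w_j · K_j = L^{3(j₀ − j)} · (1+θ)` and `L^{3(j₀−j)} = (L³)^s (L⁻³)^{j+s−j₀}`
      have hLj : (0 : ℝ) < (L : ℝ) ^ j := by positivity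
      have hwt : ((L : ℝ) ^ j₀ * i.η) ^ 3 * (wQ (d := d) L i.η j *
          ((1 + thetaGen d L (alphaQ d L)) * ((L : ℝ) ^ j * (((L : ℝ) ^ j) ^ d)⁻¹))) =
            (1 + thetaGen d L (alphaQ d L)) * (((L : ℝ) ^ 3) ^ s * (((L : ℝ) ^ 3)⁻¹) ^ (j + s - j₀)) := by
        obtain ⟨n, hn⟩ : ∃ n, n = j + s - j₀ := ⟨_, rfl⟩
        have hn' : j₀ + n = s + j := by omega
        rw [← hn]
        have hkey : ((L : ℝ) ^ 3) ^ j₀ * ((L : ℝ) ^ 3) ^ n = ((L : ℝ) ^ 3) ^ s * ((L : ℝ) ^ 3) ^ j := by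
          rw [← pow_add, ← pow_add, hn']
        have hη0 : i.η ≠ 0 := hη.ne'
        have h1 : ((L : ℝ) ^ j₀ * i.η) ^ 3 * ((((L : ℝ) ^ j * i.η) ^ 3)⁻¹) = ((L : ℝ) ^ 3) ^ j₀ * (((L : ℝ) ^ 3) ^ j)⁻¹ := by
          field_simp
          ring
        have h2 : (((L : ℝ) ^ j) ^ d * ((L : ℝ) ^ j)⁻¹) * ((L : ℝ) ^ j * (((L : ℝ) ^ j) ^ d)⁻¹) = 1 := by
          field_simp
        calc ((L : ℝ) ^ j₀ * i.η) ^ 3 * (wQ (d := d) L i.η j *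
              ((1 + thetaGen d L (alphaQ d L)) * ((L : ℝ) ^ j * (((L : ℝ) ^ j) ^ d)⁻¹)))
            = (1 + thetaGen d L (alphaQ d L)) * (((L : ℝ) ^ j₀ * i.η) ^ 3 * ((((L : ℝ) ^ j * i.η) ^ 3)⁻¹)) *
                ((((L : ℝ) ^ j) ^ d * ((L : ℝ) ^ j)⁻¹) * ((L : ℝ) ^ j * (((L : ℝ) ^ j) ^ d)⁻¹)) := by
              unfold wQ; ring
          _ = (1 + thetaGen d L (alphaQ d L)) * (((L : ℝ) ^ 3) ^ j₀ * (((L : ℝ) ^ 3) ^ j)⁻¹) := by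
              rw [h1, h2, mul_one]
          _ = (1 + thetaGen d L (alphaQ d L)) * (((L : ℝ) ^ 3) ^ s * (((L : ℝ) ^ 3)⁻¹) ^ n) := by
              rw [inv_pow]
              congr 1
              rw [← div_eq_mul_inv, ← div_eq_mul_inv, div_eq_div_iff (by positivity) (by positivity), hkey]
      calc ((L : ℝ) ^ j₀ * i.η) ^ 3 * ‖(wQ (d := d) L i.η j) • linCovIterT τ L U₀ j (clsField L ΛbP i.η m j U₀ A) y μ‖
          = ((L : ℝ) ^ j₀ * i.η) ^ 3 * (wQ (d := d) L i.η j * ‖linCovIterT τ L U₀ j (clsField L ΛbP i.η m j U₀ A) y μ‖) := by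
            rw [norm_smul, Real.norm_of_nonneg (wQ_nonneg L hη.le j)]
        _ ≤ ((L : ℝ) ^ j₀ * i.η) ^ 3 * (wQ (d := d) L i.η j *
              (Cτ * betaTau τ * ((1 + thetaGen d L (alphaQ d L)) * ((L : ℝ) ^ j * (((L : ℝ) ^ j) ^ d)⁻¹)) * (2 * d * W))) := by
            refine mul_le_mul_of_nonneg_left (mul_le_mul_of_nonneg_left (hT.trans ?_) (wQ_nonneg L hη.le j)) (by positivity)
            exact mul_le_mul_of_nonneg_left hsumW (by positivity)
        _ = C * W * (((L : ℝ) ^ 3) ^ s * (((L : ℝ) ^ 3)⁻¹) ^ (j + s - j₀)) := by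
            rw [hC]
            linear_combination (Cτ * betaTau τ * (2 * d * W)) * hwt
    · -- no window bond is a class bond: the level-`j` term vanishes
      simp only [not_exists] at hP
      have hzero : ∑ κ : Fin d, ∑ t : Fin 2, ‖clsField L ΛbP i.η m j U₀ A (winBase L j y κ t) κ‖ = 0 := by
        refine Finset.sum_eq_zero fun κ _ => Finset.sum_eq_zero fun t _ => ?_
        have h := hval κ t
        rw [if_neg (hP κ t)] at h
        exact le_antisymm h (norm_nonneg _)
      rw [hzero, mul_zero] at hT
      have hT0 : linCovIterT τ L U₀ j (clsField L ΛbP i.η m j U₀ A) y μ = 0 := norm_le_zero_iff.1 hT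
      rw [hT0, smul_zero, norm_zero, mul_zero]
      split_ifs <;> positivity
  -- (4) sum the levels
  calc ((L : ℝ) ^ j₀ * i.η) ^ 3 *
        ‖∑ j ∈ Finset.range (m + 1), (wQ (d := d) L i.η j) • linCovIterT τ L U₀ j (clsField L ΛbP i.η m j U₀ A) y μ‖
      ≤ ((L : ℝ) ^ j₀ * i.η) ^ 3 *
          ∑ j ∈ Finset.range (m + 1), ‖(wQ (d := d) L i.η j) • linCovIterT τ L U₀ j (clsField L ΛbP i.η m j U₀ A) y μ‖ :=
        mul_le_mul_of_nonneg_left (norm_sum_le _ _) (by positivity)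
    _ = ∑ j ∈ Finset.range (m + 1),
          ((L : ℝ) ^ j₀ * i.η) ^ 3 * ‖(wQ (d := d) L i.η j) • linCovIterT τ L U₀ j (clsField L ΛbP i.η m j U₀ A) y μ‖ := by
        rw [Finset.mul_sum]
    _ ≤ ∑ j ∈ Finset.range (m + 1),
          C * W * (if j₀ ≤ j + s then ((L : ℝ) ^ 3) ^ s * (((L : ℝ) ^ 3)⁻¹) ^ (j + s - j₀) else 0) := Finset.sum_le_sum hlevel
    _ = C * W * ∑ j ∈ Finset.range (m + 1),
          (if j₀ ≤ j + s then ((L : ℝ) ^ 3) ^ s * (((L : ℝ) ^ 3)⁻¹) ^ (j + s - j₀) else 0) := by rw [Finset.mul_sum]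
    _ ≤ C * W * (2 * ((L : ℝ) ^ 3) ^ s) := mul_le_mul_of_nonneg_left (level_sum_le hL m j₀ s) (by positivity)
    _ = qQ d L Cτ (betaTau τ) s * W := by rw [hC, qQ]; ring

/-- ★★ **THE MEMBER'S OWN CLASS**: at `ΛbP := i.Λb` the above IS `B9SupplySockB9P3ZdAt.AvgAt` for the genuine letter (`avgAtP_self`).
[cite: Balaban1985BackgroundPropagators, (3.16) p.393; Balaban1985RegularSpaces, (1.56), (1.58) p.86] -/
theorem avgAt_withQQ (hd : 2 ≤ d) (hL : 2 ≤ L)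
    {Cτ : ℝ} (hCτ : ∀ x y : 𝔸, |(τ (star x * y)).re| ≤ Cτ * ‖x‖ * ‖y‖)
    (ops₀ : ℝ → ZdIdx d L → ℕ → OpsZd d 𝔸) (M : ℝ) (i : ZdIdx d L)
    (m : ℕ) {s : ℕ} (hlaw : LevelSepP L m i.Ω i.Λb s) :
    AvgAt L (withQQ τ L i.Λb ops₀) (qQ d L Cτ (betaTau τ) s) M i m :=
  (avgAtP_self L _ _ M i m).1 (avgAtP_withQQ τ L hd hL hCτ i.Λb ops₀ M i m hlaw)

end Letter


/-! ## §5b Genuineness: in the regime every column is real-linear, so `Q_jᵀ` IS the `⟨·,·⟩_τ`-transpose column by column, and the summed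
pairing identity `Σ_b ⟨(Q_jᵀB)(b), A(b)⟩_τ = Σ_c ⟨B(c), (LʲQ_jA)(c)⟩_τ` holds for finitely supported fields -/

section Genuine

open B7Prop1Explicit (e)
open B7Prop1Local (InBox AgreeOn loK bondHiK clampCfg clampCfg_agree clampCfg_mem)
open B7Prop2Explicit (unitaryUnits avgClosed_unitaryUnits C0 c2' C0_pos)
open B7Prop5Flat (BondIn bump)
open B7Prop4GeneralLevels (linCovIter)
open B7Prop5GeneralLevels (thetaGen hadd_levels hsmul_levels)
open B7Prop5GeneralLinear (linCovIter_line)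

variable [Nontrivial 𝔸]

/-- ★ **THE COLUMNS ARE REAL-LINEAR IN THE REGIME**: for a unitary `U₀` in the class (1.7) (`α ≤ α_Q`) and a level-`j` bond `c` whose box lies in `Ω_j`,
the column `X ↦ LʲQ_j(U₀)(X·δ_b)(c)` is additive and real-homogeneous ([5] (122): the linear part IS linear at regular backgrounds —
`hadd_levels`∕`hsmul_levels` at the clamped extension, transported by locality). [cite: Balaban1985Averaging, (122) p.36, p.38 (before (133)), p.24] -/
theorem column_linear_of_reg17 {L : ℕ} (hL : 2 ≤ L) {m : ℕ} {Ω : ℕ → Set (Site d)} {α : ℝ} (hα : 0 < α)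
    (hαQ : α ≤ alphaQ d L) {U₀ : Site d → Fin d → 𝔸ˣ} (hU₀ : ∀ x κ, U₀ x κ ∈ unitaryUnits 𝔸) (hreg : Reg17 L m Ω α U₀)
    {j : ℕ} (hj : j ≤ m) (z : Site d) (κ : Fin d) (hbox : ∀ x, InBox (loK L j z) (bondHiK L j z κ) x → x ∈ Ω j)
    (y : Site d) (μ : Fin d) :
    (∀ X X' : 𝔸, linCovIter L U₀ (bump y μ (X + X')) j z κ =
        linCovIter L U₀ (bump y μ X) j z κ + linCovIter L U₀ (bump y μ X') j z κ) ∧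
      (∀ (r : ℝ) (X : 𝔸), linCovIter L U₀ (bump y μ (r • X)) j z κ = r • linCovIter L U₀ (bump y μ X) j z κ) := by
  have hL1 : 1 ≤ L := le_trans (by norm_num) hL
  obtain ⟨hUG, hpdev, hag⟩ := clamp_data hL1 hα hU₀ hreg hj z κ hbox
  have hα3 : C0 d * α ≤ 1 / 3 := (mul_le_mul_of_nonneg_left hαQ (C0_pos d).le).trans (C0_mul_alphaQ_le d L)
  have hα4 : 4 * α ≤ c2' d L := by linarith [four_mul_alphaQ_le d L]
  set U' := clampCfg (loK L j z) (bondHiK L j z κ) U₀ with hU'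
  have hadd := hadd_levels L hL (avgClosed_unitaryUnits d L) j U' hUG hα hα3 hα4 hpdev
  have hsmul := hsmul_levels L hL (avgClosed_unitaryUnits d L) j U' hUG hα hα3 hα4 hpdev
  -- transport every column to the clamped background
  have htr : ∀ B : Site d → Fin d → 𝔸, linCovIter L U₀ B j z κ = linCovIter L U' B j z κ :=
    fun B => linCovIter_congr L hL1 j z κ hag.symm (fun _ _ _ _ => rfl)
  have hbadd : ∀ X X' : 𝔸, bump y μ (X + X') = bump y μ X + (1 : ℂ) • bump y μ X' := by
    intro X X'; funext x ν; simp only [bump, Pi.add_apply, one_smul]; split_ifs <;> simp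
  have hbsmul : ∀ (r : ℝ) (X : 𝔸), bump y μ (r • X) = (0 : Site d → Fin d → 𝔸) + ((r : ℂ)) • bump y μ X := by
    intro r X; funext x ν; simp only [bump, Pi.add_apply, Pi.smul_apply, Pi.zero_apply, zero_add]
    split_ifs <;> simp [Complex.coe_smul]
  refine ⟨fun X X' => ?_, fun r X => ?_⟩
  · rw [htr, htr, htr, hbadd, linCovIter_line L U' j hadd hsmul _ _ j le_rfl, one_smul]
  · rw [htr, htr, hbsmul, linCovIter_line L U' j hadd hsmul _ _ j le_rfl, linCovIter_zero_fun, Pi.zero_apply, Pi.zero_apply,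
      zero_add, Complex.coe_smul]

end Genuine

/-! ## §5 A6: the abelian fibre `𝔸 = ℂ`, `τ = id` — every fibre hypothesis discharged -/

section Complex

open B8LeafModelZd (ZdIdx)
open B9SupplySockB9P3ZdLetters (OpsZd)
open B9SupplySockB9P3ZdGammaUniv (AvgAtP)

/-- the identity functional on `ℂ` obeys `|Re (x̄·y)| ≤ ‖x‖‖y‖`. [folklore] -/
private theorem abs_re_star_mul_le_complex (x y : ℂ) :
    |((LinearMap.id : ℂ →ₗ[ℂ] ℂ) (star x * y)).re| ≤ 1 * ‖x‖ * ‖y‖ := by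
  rw [LinearMap.id_apply, one_mul]
  calc |(star x * y).re| ≤ ‖star x * y‖ := Complex.abs_re_le_norm _
    _ = ‖x‖ * ‖y‖ := by rw [norm_mul, norm_star]

/-- ★ **A6 AT THE ABELIAN FIBRE**: at `𝔸 = ℂ`, `τ = id` the binder `AvgAtP` holds for the genuine letter with NO fibre hypothesis left
(`C_τ = 1`): `AvgAtP L (withQQ id L ΛbP ops₀) (qQ d L 1 β_id s) ΛbP M i m` for every member and every class obeying `LevelSepP`; together with
`reg17_one` (the class (1.7) contains `U₀ = 1`, where the letter is the genuine sum) the theorem is not vacuous. [cite: Balaban1985BackgroundPropagators, (3.16) p.393; Balaban1985RegularSpaces, (1.56), (1.58) p.86] -/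
theorem avgAtP_withQQ_complex (hd : 2 ≤ d) {L : ℕ} (hL : 2 ≤ L) (ΛbP : ℕ → ℕ → Set (Site d × Fin d))
    (ops₀ : ℝ → ZdIdx d L → ℕ → OpsZd d ℂ) (M : ℝ) (i : ZdIdx d L) (m : ℕ) {s : ℕ} (hlaw : LevelSepP L m i.Ω ΛbP s) :
    AvgAtP L (withQQ (LinearMap.id : ℂ →ₗ[ℂ] ℂ) L ΛbP ops₀) (qQ d L 1 (betaTau (LinearMap.id : ℂ →ₗ[ℂ] ℂ)) s) ΛbP M i m :=
  avgAtP_withQQ (LinearMap.id : ℂ →ₗ[ℂ] ℂ) L hd hL abs_re_star_mul_le_complex ΛbP ops₀ M i m hlaw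

end Complex

end Literature.MathematicalPhysics.QuantumFieldTheory.Balaban1983to89.B9Eq316AveragingTransposeZd

end
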